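import Literature.MathematicalPhysics.QuantumFieldTheory.Balaban1983to89.B4ContourShift

/-!
# `Balaban1983to89.B4TorusKernel` — from the `ℤ^{d+1}`-lattice kernel to the FINITE-TORUS kernel: periodisation of an
# exponentially decaying kernel (uniform in the period `N`) and Poisson summation on the discrete torus `(ℤ/N)^{d+1}`

T. Bałaban, *Propagators and renormalization transformations for lattice gauge theories. I*, Commun. Math. Phys. **95**, 17–40
(1984) [Balaban1984PropagatorsI] (cell paper B5), p. 23 [PDF 7] (1.29), p. 25 [PDF 9] l. 35–36, p. 36 [PDF 20] l. 20–23, p. 38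
[PDF 22] (1.126); T. Bałaban, *Regularity and decay of lattice Green's functions*, Commun. Math. Phys. **89**, 571–597 (1983)
[Balaban1983RegularityDecay] (cell paper B4), p. 586 [PDF 16] l. 11–15 (the decay step this supplements, see `…B4ContourShift`).

CITATION HEADER (lean-in-tree rule 2026-08-18).  This module is a SUPPLEMENT to the sibling module `…Balaban1983to89.B4ContourShift`
(imported; there: for a strip-regular multiplier `G` on `[-π,π]^{d+1} + i[-κ,κ]^{d+1}` the `ℤ^{d+1}`-LATTICE kernel
`latticeKernel G x = (2π)^{-(d+1)} ∫_{[-π,π]^{d+1}} G(p) e^{ip·x} dp` obeys `|K(x)| ≤ M e^{-κ|x|_∞}`, `latticeKernel_decay`,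
`latticeKernel_inv_decay`).  It is NOT a quotation of the papers.  The operators of B5 live on a FINITE TORUS, and their kernels are
finite Fourier sums over the dual torus, B5 p. 23 [PDF 7] (VERBATIM): "The momentum representation on an arbitrary torus
T′_η = {x ∈ ηZ^d : −L′_μ ≤ x_μ < L′_μ, μ = 1, …, d} is introduced by the Fourier transform
f̃(p) = Σ_{x∈T′_η} η^d e^{−ip·x} f(x), p ∈ T̃′_η,  f(x) = (2π)^{−d} Σ_{p∈T̃′_η} (Π_{μ=1}^{d} π/L′_μ) e^{ix·p} f̃(p),  (1.29)  where T̃′_η is a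
dual torus T̃′_η = {p = (p₁, …, p_d): p_μ = (π/L′_μ)n_μ, n_μ is an integer, −L′_μη^{−1} ≤ n_μ < L′_μη^{−1}, μ = 1, …, d}."; the operator
whose kernel decay (1.126) asserts is such a multiplier, p. 25 [PDF 9] l. 35–36 (VERBATIM): "It is a translation invariant operator
on the unit lattice T₁^{(k)} and its Fourier transform can be written using formula (2.48)"; and the passage from the torus to the
infinite lattice is invoked, not written, p. 36 [PDF 20] l. 20–23 (VERBATIM): "Probably the simplest proof of the exponential decay
properties can be obtained by relating G on the torus to G on the whole lattice ηZ^d in the usual way".  The cell `pub-balaban`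
recorded the torus step in prose only (`HOME/b2b-balaban-b05-g2/QGGQ-strip-census.md` §3: "Unit torus T₁^{(k)} (periods ℓ_μ ≥ 1): its
kernel is the periodization Σ_{n∈ℤ^d} K_N(y + ℓn) (the torus Fourier sum samples 1/m_N on the dual lattice = Poisson summation), so
… ≤ c_m⁻¹ (1 + 2e^{κ/4d}/(1 − e^{−κ/2d}))^d e^{−(κ/2) dist_∞(y,y′)}"; GAPS rows C-B5-18 / C-B5-18K list it among the untyped
residuals of (1.126)).  THIS FILE PROVES "THE USUAL WAY" IN THE KERNEL, as two generic engines and their composite: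

 * §1–§3 PERIODISATION BOUND `periodise_bound`, `periodise_bound_supNorm`: for ANY lattice function `K : ℤ^{d+1} → ℂ` with
   `‖K(y)‖ ≤ M e^{−κ|y|_∞}`, `κ > 0`, any period `N ≥ 1` and any centred representative `x` (`2|x_i| ≤ N`), the series
   `Σ_{m∈ℤ^{d+1}} K(x + Nm)` converges absolutely and `‖Σ_m K(x + Nm)‖ ≤ M·C(κ,d)·e^{−(κ/(d+1)) Σ_i|x_i|} ≤ M·C(κ,d)·e^{−(κ/(d+1))|x|_∞}`,
   `C(κ,d) = periodConst κ d = (2e^{κ'}/(1 − e^{−κ'}))^{d+1}`, `κ' = κ/(d+1)`, INDEPENDENT of `N` (§1 `summable_prod_pi`: Fubini for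
   nonnegative product series over `ℤ^k`; §2 the two-sided geometric series and the integer inequality `|y + Nj| ≥ |y| + |j| − 1` for
   `2|y| ≤ N`, `N ≥ 1`; §3 `e^{−κ|y|_∞} ≤ Π_i e^{−κ'|y_i|}` and the termwise majorant).
 * §4 POISSON SUMMATION ON THE DISCRETE TORUS `torusSum_eq_periodise`: for `f ∈ C((ℝ/ℤ)^{d+1}, ℂ)` with absolutely summable
   Fourier coefficients `ĉ = UnitAddTorus.mFourierCoeff f` and `N ≥ 1`,
   `Σ_{k∈(ℤ/N)^{d+1}} f(k/N) Π_i e^{2πi x_i k_i/N} = N^{d+1} Σ_{m∈ℤ^{d+1}} ĉ(−x + Nm)` (Mathlib's pointwise Fourier series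
   `UnitAddTorus.hasSum_mFourier_series_apply_of_summable`, the character sums `sum_fourier_grid` / `sum_mFourier_grid` on `ℤ/N`,
   and reindexing along the injective map `m ↦ −x + Nm`).  DICTIONARY with (1.29) on the unit lattice (`η = 1`, `2L′_μ = N` sites):
   the dual-torus momentum is `p_μ = 2πk_μ/N`, i.e. the grid point `k/N ∈ ℝ/ℤ` of `gridPt`, and for `f(t) = G(2πt)` the normalised sum
   `torusKernel f N x = N^{−(d+1)} Σ_k f(k/N) e^{2πi k·x/N}` is the kernel `(2π)^{−d} Σ_p (Π π/L′_μ) e^{ix·p} G(p)` of (1.29).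
 * §5 COMPOSITE `torusKernel_eq_periodise` (torus kernel = periodised coefficient sequence) and `torusKernel_decay`: if
   `‖ĉ(n)‖ ≤ M e^{−κ|n|_∞}`, `κ > 0`, then for every `N ≥ 1` and centred `x`, `‖torusKernel f N x‖ ≤ M·C(κ,d)·e^{−(κ/(d+1))|x|_∞}` —
   decay in the torus distance, constants depending on `κ, d` only, uniformly in the period; `summable_of_decay` (decay ⇒ `ĉ ∈ ℓ¹`).
 * §6 THE DICTIONARY (v2): for a STRIP-REGULAR multiplier (`B4ContourShift.StripRegular G κ M`, `κ ≥ 0`) the function `s ↦ G(2πs)`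
   on the closed box `[-1/2,1/2]^{d+1}` takes equal values on opposite faces (`face_match`, from `StripRegular.sides` at `Im = 0`, one
   coordinate at a time), hence DESCENDS to `descend G : (ℝ/ℤ)^{d+1} → ℂ`, `t ↦ G(2π rep t)` (`rep` = the representative in
   `[-1/2,1/2)`, B5's `−L′_μ ≤ n_μ < L′_μ`), which is CONTINUOUS (`continuous_descend`: the box is compact and the torus Hausdorff, so
   `s ↦ s mod ℤ^{d+1}` is a quotient map — `Continuous.isClosedMap`, `IsClosedMap.isQuotientMap`); its Fourier coefficients ARE the
   lattice kernel, `mFourierCoeff_descend : ĉ(n) = latticeKernel G (−n)` (substitution `p = 2πt` in `UnitAddTorus.mFourierCoeff_eq_integral`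
   via `Measure.setIntegral_comp_smul_of_pos`, the half-open cell `∏(-π,π]` versus `[-π,π]^{d+1}` being a null difference,
   `Measure.univ_pi_Ioc_ae_eq_Icc`); whence `norm_mFourierCoeff_descend_le` (from `latticeKernel_decay`), the identification
   `torusKernel_descend_eq : N^{−(d+1)} Σ_k G(2π rep(k/N)) e^{2πi k·x/N} = Σ_m latticeKernel G (x + Nm)` and the headline
   `torusKernel_descend_decay : StripRegular G κ M → 0 < κ → 1 ≤ N → (∀ i, 2|x_i| ≤ N) → ‖torusKernel (descendC G h _) N x‖ ≤
   M · periodConst κ d · e^{−(κ/(d+1))|x|_∞}` — B5 (1.126) ON THE TORUS for the generic multiplier, uniformly in the period.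
 * §7 UNEQUAL PERIODS (v3, sub-namespace `MultiPeriod`): the same chain for a period VECTOR `N : Fin (d+1) → ℕ`, all `N_μ ≥ 1` —
   B5's torus `{−L_μ ≤ x_μ < L_μ, μ = 1, …, d}` (p. 17 [PDF 1] l. 30) and dual torus `−L′_μ ≤ n_μ < L′_μ` (p. 23 (1.29)) with
   μ-DEPENDENT sizes: `MultiPeriod.translate N x m = x + (N_μ m_μ)_μ`, `MultiPeriod.periodise_bound(_supNorm)` (same constant
   `M · periodConst κ d`, independent of the period vector), the grid `(k_μ/N_μ)_μ` (`MultiPeriod.gridPt`, dependent index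
   `k : (μ : Fin (d+1)) → Fin (N μ)`), the character sum `MultiPeriod.sum_mFourier_grid` (`= Π_μ N_μ` iff `N_μ ∣ n_μ ∀μ`), Poisson
   summation `MultiPeriod.torusSum_eq_periodise` (`Σ_k f(k/N) Π_μ e^{2πi x_μk_μ/N_μ} = (Π_μ N_μ) Σ_m ĉ(−x + Nm)`), the normalised
   kernel `MultiPeriod.torusKernel f N x = (Π_μ N_μ)^{-1} · MultiPeriod.torusSum f N x`, `MultiPeriod.torusKernel_decay`,
   `MultiPeriod.torusKernel_descend_eq` and the headline `MultiPeriod.torusKernel_descend_decay : StripRegular G κ M → 0 < κ →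
   (∀ μ, 1 ≤ N μ) → (∀ μ, 2|x_μ| ≤ N μ) → ‖MultiPeriod.torusKernel (descendC G h _) N x‖ ≤ M · periodConst κ d · e^{−(κ/(d+1))|x|_∞}`;
   `MultiPeriod.torusKernel_const`: for the constant period vector it is the §5 kernel.  (The §3–§6 proofs were coordinatewise; §7
   repeats them with `N ↦ N_μ`; the equal-period declarations are unchanged.)
 * §8 THE TORUS METRIC (v4, in `MultiPeriod`): `circAbs N x = dist(x, Nℤ) = min (x mod N, N − x mod N)`, the centring translation
   `centre` / `centreVec` (`|x + N·centre N x| = circAbs N x`, `abs_add_mul_centre`), `torusSupNorm N x = max_μ dist(x_μ, N_μℤ)` = the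
   sup-distance on `Π_μ ℤ/N_μ` between the classes of `x` and `0` (`torusSupNorm_le_supNorm`; `torusSupNorm_of_centred`: `= supNorm x`
   when `2|x_μ| ≤ N_μ`; `torusSupNorm_translate`: invariant under `x ↦ x + (N_μm_μ)_μ`), the PERIODICITY of the torus kernel
   `MultiPeriod.torusKernel_translate : torusKernel f N (translate N x m) = torusKernel f N x` (the grid characters are `N_μ`-periodic,
   `mFourier_translate_gridPt`), and the headlines WITHOUT a centring hypothesis, for EVERY `x ∈ ℤ^{d+1}`:
   `MultiPeriod.torusKernel_decay_torusMetric` and `MultiPeriod.torusKernel_descend_decay_torusMetric : StripRegular G κ M → 0 < κ →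
   (∀ μ, 1 ≤ N μ) → ∀ x, ‖MultiPeriod.torusKernel (descendC G h _) N x‖ ≤ M · periodConst κ d · e^{−(κ/(d+1)) · torusSupNorm N x}` —
   decay in the TORUS METRIC, uniformly in the period vector (the form in which kernel-by-kernel consumers read p. 36 l. 20–23; cell
   records GAPS G-pv07-2 (b), G-B5-19).
Inputs: Mathlib only (multi-variable Fourier series on `UnitAddTorus`, `tsum` algebra, geometric series) and the NOTATION `supNorm` of
`B4ContourShift`.  NO published theorem is used as a hypothesis, NO statement of the series is asserted, no `…Printed` Prop of the
sibling modules is used.  No `sorry`, no axiom, no `opaque`.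
DIMENSION / PERIOD CONVENTION: lattice `ℤ^{d+1}` (`Fin (d+1)`) as in `B4ContourShift`; the period `N ≥ 1` is arbitrary (B5's tori
have `N = 2L′_μ`, resp. `N = L_μ/L^kε` per direction) — equal periods in all directions in §3–§6, a general period vector
`(N_μ)_μ` in §7–§8 (`MultiPeriod`).
Inputs of §6: Mathlib (quotient maps, `AddCircle.equivIco`, Haar change of variables) and `B4ContourShift` (`StripRegular`,
`latticeKernel_decay`, `ofRealVec_insertNth`, `ofRealVec_mem_Strip`).
NOT IN SCOPE (stay where the cell records have them): (a) the INSTANTIATION `G = 1/m(p′)` of B5 (1.45) (cell node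
C-B5-18-INPUTS-KERNEL, module `B5Strip145Analytic`, and the joiner `B5Strip145Decay`: `stripRegular_inv` + `torusKernel_descend_decay`);
(b) v2's deferred item — unequal periods `N_μ` — is §7; (c) the Hölder part (1.127); (d) v1's deferred item — the identification
`ĉ(n) = latticeKernel G (−n)` — is §6; (e) the composition `P = G′Q′*(Q′G′²Q′*)⁻¹Q′G′` of p. 38 (mixed fine/unit lattices) and the
`η`-lattice (fine torus) version of the periodisation.  VALUE: kernel certificate (generic engine) of a located, invoked-not-written step ("in the
usual way") on the path B5 (1.45) ⟶ (1.126); it is NOT a result of the papers and NOT progress on any summit.  Unit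
`b2b-balaban-pv17` (surge node prover #17, gen 2).  Staged byte-identically in the cell package
`run/shared/lean/pub/pub-balaban/lean/BalabanYm4/Literature/MathematicalPhysics/QuantumFieldTheory/Balaban1983to89/B4TorusKernel.lean`.
Companion records: QGGQ-strip-census.md §3 (B05 gen 2), GAPS.md rows C-B5-18 / C-B5-18K / C-pv17-27 / C-pv17-29 / C-pv17-31 (this unit).
-/

namespace Literature.MathematicalPhysics.QuantumFieldTheory.Balaban1983to89.B4TorusKernel

open Complex Set MeasureTheory Finset
open Literature.MathematicalPhysics.QuantumFieldTheory.Balaban1983to89.B4Strip (ofRealVec Strip)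
open Literature.MathematicalPhysics.QuantumFieldTheory.Balaban1983to89.B4ContourShift
open scoped Real

noncomputable section

variable {d : ℕ}

/-! ### §1. Sums of products over `ℤ^k` -/

/-- a product of summable nonnegative sequences is summable over `ℤ^k` and its sum is the product of the sums
(Fubini for nonnegative series, by induction on `k`). [folklore] -/
theorem summable_prod_pi {k : ℕ} (a : Fin k → ℤ → ℝ) (h0 : ∀ i j, 0 ≤ a i j) (hs : ∀ i, Summable (a i)) :
    Summable (fun m : Fin k → ℤ => ∏ i, a i (m i)) ∧
      ∑' m : Fin k → ℤ, ∏ i, a i (m i) = ∏ i, ∑' j, a i j := by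
  induction k with
  | zero =>
    refine ⟨.of_finite, ?_⟩
    rw [tsum_fintype]
    simp
  | succ k ih =>
    have ih' := ih (fun i => a i.succ) (fun i j => h0 _ _) (fun i => hs _)
    have ih1 : Summable (fun m : Fin k → ℤ => ∏ i : Fin k, a i.succ (m i)) := ih'.1
    have ih2 : ∑' m : Fin k → ℤ, ∏ i : Fin k, a i.succ (m i) = ∏ i : Fin k, ∑' j, a i.succ j := ih'.2
    have hg0 : ∀ m : Fin k → ℤ, 0 ≤ ∏ i : Fin k, a i.succ (m i) :=
      fun m => Finset.prod_nonneg fun i _ => h0 i.succ (m i)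
    have hf0 : ∀ j : ℤ, 0 ≤ a 0 j := fun j => h0 0 j
    let E : ℤ × (Fin k → ℤ) ≃ (Fin (k + 1) → ℤ) := Fin.consEquiv (fun _ : Fin (k + 1) => ℤ)
    have hsum2 : Summable (fun z : ℤ × (Fin k → ℤ) => a 0 z.1 * ∏ i : Fin k, a i.succ (z.2 i)) :=
      Summable.mul_of_nonneg (f := a 0) (g := fun m : Fin k → ℤ => ∏ i : Fin k, a i.succ (m i)) (hs 0) ih1 hf0 hg0
    have hcomp : ∀ z : ℤ × (Fin k → ℤ),
        (∏ i, a i (E z i)) = a 0 z.1 * ∏ i : Fin k, a i.succ (z.2 i) := by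
      intro z
      rw [Fin.prod_univ_succ]
      rfl
    refine ⟨?_, ?_⟩
    · have h2 : Summable (fun z : ℤ × (Fin k → ℤ) => ∏ i, a i (E z i)) :=
        hsum2.congr (fun z => (hcomp z).symm)
      exact E.summable_iff.mp h2
    · have h1 : ∑' m : Fin (k + 1) → ℤ, ∏ i, a i (m i)
          = ∑' z : ℤ × (Fin k → ℤ), a 0 z.1 * ∏ i : Fin k, a i.succ (z.2 i) := by
        rw [← E.tsum_eq]
        exact tsum_congr (fun z => hcomp z)
      rw [h1, Fin.prod_univ_succ, ← ih2]
      exact (Summable.tsum_mul_tsum (f := a 0) (g := fun m : Fin k → ℤ => ∏ i : Fin k, a i.succ (m i))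
        (hs 0) ih1 hsum2).symm

/-! ### §2. One dimension: the two-sided geometric series and the periodised exponential -/

/-- `Σ_{j ∈ ℤ} r^{|j|}` converges for `0 ≤ r < 1` and is at most `2/(1-r)`. [folklore] -/
theorem summable_geometric_int {r : ℝ} (h0 : 0 ≤ r) (h1 : r < 1) :
    Summable (fun j : ℤ => r ^ j.natAbs) ∧ ∑' j : ℤ, r ^ j.natAbs ≤ 2 / (1 - r) := by
  set f : ℤ → ℝ := fun j => r ^ j.natAbs with hf
  have hg := summable_geometric_of_lt_one h0 h1
  have hnat : (fun n : ℕ => f n) = fun n => r ^ n := by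
    funext n; simp [hf]
  have hneg1 : (fun n : ℕ => f (-(n + 1 : ℤ))) = fun n => r ^ (n + 1) := by
    funext n
    simp only [hf]
    congr 1
  have h1' : Summable fun n : ℕ => f n := by rw [hnat]; exact hg
  have h3' : Summable fun n : ℕ => r ^ (n + 1) := by
    simpa [pow_succ] using hg.mul_right r
  have h3 : Summable fun n : ℕ => f (-(n + 1 : ℤ)) := by rw [hneg1]; exact h3'
  have hs : Summable f := Summable.of_nat_of_neg_add_one h1' h3
  refine ⟨hs, ?_⟩
  rw [tsum_of_nat_of_neg_add_one (f := f) h1' h3, hnat, hneg1, tsum_geometric_of_lt_one h0 h1]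
  have e2 : ∑' n : ℕ, r ^ (n + 1) ≤ (1 - r)⁻¹ := by
    calc ∑' n : ℕ, r ^ (n + 1) ≤ ∑' n : ℕ, r ^ n :=
          h3'.tsum_le_tsum (fun n => by
            rw [pow_succ]; exact mul_le_of_le_one_right (pow_nonneg h0 n) h1.le) hg
      _ = (1 - r)⁻¹ := tsum_geometric_of_lt_one h0 h1
  have hpos : 0 < 1 - r := by linarith
  rw [div_eq_mul_inv, two_mul]
  linarith

/-- the key integer inequality behind the periodised bound: for a centred representative `2|y| ≤ N`, `N ≥ 1`, every
translate satisfies `|y + N j| ≥ |y| + |j| - 1`. [folklore] -/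
theorem abs_add_mul_ge (y j : ℤ) {N : ℕ} (hN : 1 ≤ N) (hy : 2 * |y| ≤ N) :
    (|y| : ℤ) + |j| - 1 ≤ |y + N * j| := by
  rcases eq_or_ne j 0 with rfl | hj
  · simp
  · have hj1 : 1 ≤ |j| := Int.one_le_abs hj
    have hN' : (1 : ℤ) ≤ N := by exact_mod_cast hN
    -- |y + N j| ≥ N|j| - |y| ≥ |y| + N|j| - N ≥ |y| + |j| - 1
    have h1 : (N : ℤ) * |j| - |y| ≤ |y + N * j| := by
      have := abs_sub_abs_le_abs_sub ((N : ℤ) * j) (-y)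
      rw [abs_mul, abs_neg, Nat.abs_cast] at this
      have e : (N : ℤ) * j - -y = y + N * j := by ring
      rw [e] at this
      linarith
    have h2 : (N : ℤ) * (|j| - 1) ≥ |j| - 1 := by nlinarith
    nlinarith

/-- ONE-DIMENSIONAL PERIODISED EXPONENTIAL: for `κ > 0`, `N ≥ 1` and a centred representative `2|y| ≤ N`,
`e^{-κ|y + Nj|} ≤ e^{κ} e^{-κ|y|} (e^{-κ})^{|j|}` for every `j ∈ ℤ`. [folklore] -/
theorem exp_translate_le {κ : ℝ} (hκ : 0 ≤ κ) (y j : ℤ) {N : ℕ} (hN : 1 ≤ N) (hy : 2 * |y| ≤ N) :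
    Real.exp (-(κ * |((y + N * j : ℤ) : ℝ)|))
      ≤ Real.exp κ * Real.exp (-(κ * |(y : ℝ)|)) * Real.exp (-κ) ^ j.natAbs := by
  rw [← Real.exp_nat_mul, ← Real.exp_add, ← Real.exp_add]
  apply Real.exp_le_exp.mpr
  have h := abs_add_mul_ge y j hN hy
  have h' : ((|y| : ℤ) : ℝ) + (|j| : ℤ) - 1 ≤ ((|y + N * j| : ℤ) : ℝ) := by exact_mod_cast h
  have e1 : ((|y + ↑N * j| : ℤ) : ℝ) = |((y + N * j : ℤ) : ℝ)| := by push_cast; rfl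
  have e2 : ((|y| : ℤ) : ℝ) = |(y : ℝ)| := by push_cast; rfl
  have e3 : ((|j| : ℤ) : ℝ) = (j.natAbs : ℝ) := by rw [← Int.natCast_natAbs]; simp
  rw [e1] at h'; rw [e2, e3] at h'
  nlinarith

/-! ### §3. Periodisation over `N ℤ^{d+1}` -/

/-- the `N`-translate `x + N m` of a lattice point. [folklore] -/
def translate (N : ℕ) (x m : Fin (d + 1) → ℤ) : Fin (d + 1) → ℤ := fun i => x i + N * m i

/-- components of the translate. [folklore] -/
@[simp] theorem translate_apply (N : ℕ) (x m : Fin (d + 1) → ℤ) (i : Fin (d + 1)) :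
    translate N x m i = x i + N * m i := rfl

/-- `Σ_i |y_i| ≤ (d+1)·|y|_∞`. [folklore] -/
theorem sum_abs_le_mul_supNorm (y : Fin (d + 1) → ℤ) :
    ∑ i, ((|y i| : ℤ) : ℝ) ≤ (d + 1) * supNorm y := by
  calc ∑ i, ((|y i| : ℤ) : ℝ) ≤ ∑ _i : Fin (d + 1), supNorm y :=
        Finset.sum_le_sum fun i _ => abs_le_supNorm y i
    _ = (d + 1) * supNorm y := by simp [Finset.sum_const, Finset.card_univ, Fintype.card_fin]

/-- `e^{-κ|y|_∞} ≤ Π_i e^{-(κ/(d+1))|y_i|}`. [folklore] -/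
theorem exp_supNorm_le_prod {κ : ℝ} (hκ : 0 ≤ κ) (y : Fin (d + 1) → ℤ) :
    Real.exp (-(κ * supNorm y)) ≤ ∏ i, Real.exp (-(κ / (d + 1) * |((y i : ℤ) : ℝ)|)) := by
  rw [← Real.exp_sum]
  apply Real.exp_le_exp.mpr
  rw [Finset.sum_neg_distrib, ← Finset.mul_sum, neg_le_neg_iff]
  have h := sum_abs_le_mul_supNorm y
  have hd : (0 : ℝ) < d + 1 := by positivity
  have e : ∑ i, |((y i : ℤ) : ℝ)| = ∑ i, ((|y i| : ℤ) : ℝ) := by simp [Int.cast_abs]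
  calc κ / (d + 1) * ∑ i, |((y i : ℤ) : ℝ)| = κ / (d + 1) * ∑ i, ((|y i| : ℤ) : ℝ) := by rw [e]
    _ ≤ κ / (d + 1) * ((d + 1) * supNorm y) := mul_le_mul_of_nonneg_left h (div_nonneg hκ hd.le)
    _ = κ * supNorm y := by field_simp

/-- the constant of the periodised bound: `C(κ, d) = (2 e^{κ'} / (1 - e^{-κ'}))^{d+1}`, `κ' = κ/(d+1)`;
it does not depend on the period `N`. [folklore] -/
def periodConst (κ : ℝ) (d : ℕ) : ℝ :=
  (2 * Real.exp (κ / (d + 1)) / (1 - Real.exp (-(κ / (d + 1))))) ^ (d + 1)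

/-- TERMWISE MAJORANT: for a centred representative `x` (`2|x_i| ≤ N`) and `‖K y‖ ≤ M e^{-κ|y|_∞}`,
`‖K(x + Nm)‖ ≤ M e^{κ'(d+1)} e^{-κ' Σ_i |x_i|} Π_i (e^{-κ'})^{|m_i|}`, `κ' = κ/(d+1)`. [folklore] -/
theorem norm_translate_le (K : (Fin (d + 1) → ℤ) → ℂ) {κ M : ℝ} (hκ : 0 ≤ κ)
    (hK : ∀ y, ‖K y‖ ≤ M * Real.exp (-(κ * supNorm y))) {N : ℕ} (hN : 1 ≤ N)
    (x : Fin (d + 1) → ℤ) (hx : ∀ i, 2 * |x i| ≤ N) (m : Fin (d + 1) → ℤ) :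
    ‖K (translate N x m)‖ ≤
      M * (Real.exp (κ / (d + 1)) ^ (d + 1) * Real.exp (-(κ / (d + 1) * ∑ i, |((x i : ℤ) : ℝ)|)))
        * ∏ i, Real.exp (-(κ / (d + 1))) ^ (m i).natAbs := by
  have hM : 0 ≤ M := by
    have h := hK 0
    exact le_trans (norm_nonneg _) h |> fun h' => by
      have hpos : 0 < Real.exp (-(κ * supNorm (0 : Fin (d + 1) → ℤ))) := Real.exp_pos _
      nlinarith [norm_nonneg (K 0)]
  set κ' := κ / (d + 1) with hκ'
  have hκ'0 : 0 ≤ κ' := div_nonneg hκ (by positivity)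
  have step : ∀ i, Real.exp (-(κ' * |((translate N x m i : ℤ) : ℝ)|))
      ≤ Real.exp κ' * Real.exp (-(κ' * |((x i : ℤ) : ℝ)|)) * Real.exp (-κ') ^ (m i).natAbs := by
    intro i
    have := exp_translate_le hκ'0 (x i) (m i) hN (hx i)
    simpa [translate] using this
  calc ‖K (translate N x m)‖ ≤ M * Real.exp (-(κ * supNorm (translate N x m))) := hK _
    _ ≤ M * ∏ i, Real.exp (-(κ' * |((translate N x m i : ℤ) : ℝ)|)) :=
        mul_le_mul_of_nonneg_left (exp_supNorm_le_prod hκ _) hM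
    _ ≤ M * ∏ i, (Real.exp κ' * Real.exp (-(κ' * |((x i : ℤ) : ℝ)|)) * Real.exp (-κ') ^ (m i).natAbs) := by
        apply mul_le_mul_of_nonneg_left _ hM
        exact Finset.prod_le_prod (fun i _ => (Real.exp_pos _).le) (fun i _ => step i)
    _ = M * (Real.exp κ' ^ (d + 1) * Real.exp (-(κ' * ∑ i, |((x i : ℤ) : ℝ)|)))
        * ∏ i, Real.exp (-κ') ^ (m i).natAbs := by
        rw [Finset.prod_mul_distrib, Finset.prod_mul_distrib, Finset.prod_const, Finset.card_univ,
          Fintype.card_fin, ← Real.exp_sum]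
        have e : ∑ i, -(κ' * |((x i : ℤ) : ℝ)|) = -(κ' * ∑ i, |((x i : ℤ) : ℝ)|) := by
          rw [Finset.mul_sum, ← Finset.sum_neg_distrib]
        rw [e]
        ring

/-- PERIODISATION BOUND. For `κ > 0`, a lattice kernel with `‖K y‖ ≤ M e^{-κ|y|_∞}`, a period `N ≥ 1`
and a centred representative `x` (`2|x_i| ≤ N` for all `i`): the periodised kernel `Σ_{m ∈ ℤ^{d+1}} K(x + Nm)`
converges absolutely and `‖Σ_m K(x + Nm)‖ ≤ M·C(κ,d)·e^{-(κ/(d+1)) Σ_i|x_i|} ≤ M·C(κ,d)·e^{-(κ/(d+1))|x|_∞}`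
with `C(κ,d) = periodConst κ d` INDEPENDENT of `N`. [B5 CMP 95 p.38: kernel of the statement for (1.126)
on the torus `T_η`, via the torus Fourier representation of §3 of `QGGQ-strip-census`] [folklore] -/
theorem periodise_bound (K : (Fin (d + 1) → ℤ) → ℂ) {κ M : ℝ} (hκ : 0 < κ)
    (hK : ∀ y, ‖K y‖ ≤ M * Real.exp (-(κ * supNorm y))) {N : ℕ} (hN : 1 ≤ N)
    (x : Fin (d + 1) → ℤ) (hx : ∀ i, 2 * |x i| ≤ N) :
    Summable (fun m : Fin (d + 1) → ℤ => K (translate N x m)) ∧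
      ‖∑' m : Fin (d + 1) → ℤ, K (translate N x m)‖
        ≤ M * periodConst κ d * Real.exp (-(κ / (d + 1) * ∑ i, |((x i : ℤ) : ℝ)|)) := by
  set κ' := κ / (d + 1) with hκ'
  have hκ'pos : 0 < κ' := div_pos hκ (by positivity)
  set r := Real.exp (-κ') with hr
  have hr0 : 0 ≤ r := (Real.exp_pos _).le
  have hr1 : r < 1 := Real.exp_lt_one_iff.mpr (by linarith)
  obtain ⟨hgs, hgle⟩ := summable_geometric_int hr0 hr1
  -- the majorant and its sum
  set A := M * (Real.exp κ' ^ (d + 1) * Real.exp (-(κ' * ∑ i, |((x i : ℤ) : ℝ)|))) with hA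
  obtain ⟨hps, hpe⟩ := summable_prod_pi (k := d + 1) (fun _ j => r ^ j.natAbs)
    (fun _ j => pow_nonneg hr0 _) (fun _ => hgs)
  have hle : ∀ m : Fin (d + 1) → ℤ, ‖K (translate N x m)‖ ≤ A * ∏ i, r ^ (m i).natAbs :=
    fun m => norm_translate_le K hκ.le hK hN x hx m
  have hmaj : Summable (fun m : Fin (d + 1) → ℤ => A * ∏ i, r ^ (m i).natAbs) := hps.mul_left A
  refine ⟨Summable.of_norm_bounded hmaj hle, ?_⟩
  have hM : 0 ≤ M := by
    have h := hK 0
    nlinarith [norm_nonneg (K 0), Real.exp_pos (-(κ * supNorm (0 : Fin (d + 1) → ℤ)))]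
  have hA0 : 0 ≤ A := by positivity
  calc ‖∑' m : Fin (d + 1) → ℤ, K (translate N x m)‖
      ≤ ∑' m : Fin (d + 1) → ℤ, A * ∏ i, r ^ (m i).natAbs := tsum_of_norm_bounded hmaj.hasSum hle
    _ = A * (∑' j : ℤ, r ^ j.natAbs) ^ (d + 1) := by
        rw [tsum_mul_left, hpe, Finset.prod_const, Finset.card_univ, Fintype.card_fin]
    _ ≤ A * (2 / (1 - r)) ^ (d + 1) := by
        apply mul_le_mul_of_nonneg_left _ hA0
        exact pow_le_pow_left₀ (tsum_nonneg fun j => pow_nonneg hr0 _) hgle _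
    _ = M * periodConst κ d * Real.exp (-(κ / (d + 1) * ∑ i, |((x i : ℤ) : ℝ)|)) := by
        rw [hA, periodConst, ← hκ', div_pow, div_pow, mul_pow]
        ring

/-- the same bound in the sup norm of the centred representative: `‖Σ_m K(x + Nm)‖ ≤ M·C(κ,d)·e^{-(κ/(d+1))|x|_∞}`
(`Σ_i |x_i| ≥ |x|_∞`). [folklore] -/
theorem periodise_bound_supNorm (K : (Fin (d + 1) → ℤ) → ℂ) {κ M : ℝ} (hκ : 0 < κ)
    (hK : ∀ y, ‖K y‖ ≤ M * Real.exp (-(κ * supNorm y))) {N : ℕ} (hN : 1 ≤ N)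
    (x : Fin (d + 1) → ℤ) (hx : ∀ i, 2 * |x i| ≤ N) :
    ‖∑' m : Fin (d + 1) → ℤ, K (translate N x m)‖
      ≤ M * periodConst κ d * Real.exp (-(κ / (d + 1) * supNorm x)) := by
  refine le_trans (periodise_bound K hκ hK hN x hx).2 ?_
  have hM : 0 ≤ M := by
    have h := hK 0
    nlinarith [norm_nonneg (K 0), Real.exp_pos (-(κ * supNorm (0 : Fin (d + 1) → ℤ)))]
  have hC : 0 ≤ periodConst κ d := by
    unfold periodConst
    apply pow_nonneg
    apply div_nonneg (by positivity)
    have : Real.exp (-(κ / (d + 1))) < 1 := Real.exp_lt_one_iff.mpr (by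
      have : 0 < κ / (d + 1) := div_pos hκ (by positivity); linarith)
    linarith
  apply mul_le_mul_of_nonneg_left _ (mul_nonneg hM hC)
  apply Real.exp_le_exp.mpr
  obtain ⟨i, hi⟩ := exists_supNorm_eq x
  have : supNorm x ≤ ∑ j, |((x j : ℤ) : ℝ)| := by
    rw [hi, Int.cast_abs]
    exact Finset.single_le_sum (f := fun j => |((x j : ℤ) : ℝ)|) (fun j _ => abs_nonneg _) (Finset.mem_univ i)
  have hκ' : 0 ≤ κ / (d + 1) := div_nonneg hκ.le (by positivity)
  nlinarith

/-! ### §4. Poisson summation on the discrete torus `(ℤ/N)^{d+1}`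

For a continuous function `f` on the unit torus `(ℝ/ℤ)^{d+1}` with absolutely summable Fourier coefficients
`ĉ = mFourierCoeff f`, the discrete inverse Fourier transform of its samples on the grid `(1/N)ℤ^{d+1}/ℤ^{d+1}`
is the periodisation of `ĉ`: `Σ_{k ∈ (ℤ/N)^{d+1}} f(k/N) e^{2πi k·x/N} = N^{d+1} Σ_{m ∈ ℤ^{d+1}} ĉ(-x + Nm)`. -/

open UnitAddTorus

/-- the grid point `k/N` of the unit torus `(ℝ/ℤ)^{d+1}` — the dual-torus momentum `p = 2πk/N` of B5 (1.29) in the period-`1`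
normalisation of Mathlib's `UnitAddTorus`. [cite: Balaban1984PropagatorsI, p. 23 (1.29), dictionary] [folklore] -/
def gridPt (N : ℕ) (k : Fin (d + 1) → Fin N) : UnitAddTorus (Fin (d + 1)) :=
  fun i => ((((k i : ℕ) : ℝ) / N : ℝ) : UnitAddCircle)

/-- the discrete inverse Fourier transform of the grid samples of `f` (un-normalised):
`Σ_{k ∈ (ℤ/N)^{d+1}} f(k/N) · Π_i e^{2πi x_i k_i / N}`. [cite: Balaban1984PropagatorsI, p. 23 (1.29), dictionary] [folklore] -/
def torusSum (f : C(UnitAddTorus (Fin (d + 1)), ℂ)) (N : ℕ) (x : Fin (d + 1) → ℤ) : ℂ :=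
  ∑ k : Fin (d + 1) → Fin N, f (gridPt N k) * mFourier x (gridPt N k)

/-- ONE-DIMENSIONAL CHARACTER SUM: `Σ_{j=0}^{N-1} e^{2πi a j/N} = N` if `N ∣ a` and `0` otherwise (`N ≥ 1`). [folklore] -/
theorem sum_fourier_grid {N : ℕ} (hN : 1 ≤ N) (a : ℤ) :
    ∑ j : Fin N, fourier a ((((j : ℕ) : ℝ) / N : ℝ) : UnitAddCircle)
      = if (N : ℤ) ∣ a then (N : ℂ) else 0 := by
  have hN0 : (N : ℂ) ≠ 0 := by exact_mod_cast (show N ≠ 0 by omega)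
  set ω : ℂ := cexp (2 * π * I * a / N) with hω
  have hterm : ∀ j : Fin N, fourier a ((((j : ℕ) : ℝ) / N : ℝ) : UnitAddCircle) = ω ^ (j : ℕ) := by
    intro j
    rw [fourier_coe_apply, hω, ← Complex.exp_nat_mul]
    congr 1
    push_cast
    field_simp
  simp_rw [hterm]
  rw [Fin.sum_univ_eq_sum_range (fun j => ω ^ j) N]
  have hωN : ω ^ N = 1 := by
    rw [hω, ← Complex.exp_nat_mul]
    have : (N : ℂ) * (2 * π * I * a / N) = a * (2 * π * I) := by field_simp
    rw [this]
    exact Complex.exp_int_mul_two_pi_mul_I a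
  split_ifs with hdiv
  · obtain ⟨c, hc⟩ := hdiv
    have hω1 : ω = 1 := by
      rw [hω, hc]
      have : 2 * (π : ℂ) * I * ((N * c : ℤ) : ℂ) / N = c * (2 * π * I) := by push_cast; field_simp
      rw [this]
      exact Complex.exp_int_mul_two_pi_mul_I c
    simp [hω1]
  · have hω1 : ω ≠ 1 := by
      intro h
      rw [hω, Complex.exp_eq_one_iff] at h
      obtain ⟨n, hn⟩ := h
      apply hdiv
      refine ⟨n, ?_⟩
      have : (a : ℂ) = N * n := by
        field_simp at hn
        exact hn
      exact_mod_cast this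
    rw [geom_sum_eq hω1, hωN]
    simp

/-- MULTI-DIMENSIONAL CHARACTER SUM over the grid: `Σ_{k ∈ (ℤ/N)^{d+1}} Π_i e^{2πi n_i k_i/N} = N^{d+1}`
if `N ∣ n_i` for all `i`, and `0` otherwise. [folklore] -/
theorem sum_mFourier_grid {N : ℕ} (hN : 1 ≤ N) (n : Fin (d + 1) → ℤ) :
    ∑ k : Fin (d + 1) → Fin N, mFourier n (gridPt N k)
      = if ∀ i, (N : ℤ) ∣ n i then (N : ℂ) ^ (d + 1) else 0 := by
  classical
  have h1 : ∀ k : Fin (d + 1) → Fin N, mFourier n (gridPt N k)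
      = ∏ i, fourier (n i) ((((k i : ℕ) : ℝ) / N : ℝ) : UnitAddCircle) := fun k => rfl
  simp_rw [h1]
  rw [← Fintype.piFinset_univ, ← Finset.prod_univ_sum (fun _ => (Finset.univ : Finset (Fin N)))
    (fun i j => fourier (n i) ((((j : ℕ) : ℝ) / N : ℝ) : UnitAddCircle))]
  simp_rw [sum_fourier_grid hN]
  split_ifs with h
  · rw [Finset.prod_congr rfl (fun i _ => if_pos (h i)), Finset.prod_const, Finset.card_univ, Fintype.card_fin]
  · obtain ⟨i, hi⟩ := not_forall.mp h
    exact Finset.prod_eq_zero (Finset.mem_univ i) (if_neg hi)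

/-- termwise bound `‖ĉ_n · mFourier_{n'}(t)‖ ≤ ‖ĉ_n‖`, hence summability of the twisted coefficient series. [folklore] -/
theorem summable_coeff_mul_mFourier (f : C(UnitAddTorus (Fin (d + 1)), ℂ)) (hs : Summable (mFourierCoeff f))
    (y : Fin (d + 1) → ℤ) (t : UnitAddTorus (Fin (d + 1))) :
    Summable (fun n => mFourierCoeff f n * mFourier (n + y) t) := by
  refine Summable.of_norm_bounded hs.norm (fun n => ?_)
  rw [norm_mul]
  have h1 : ‖mFourier (n + y) t‖ ≤ 1 :=
    ((mFourier (n + y)).norm_coe_le_norm t).trans (mFourier_norm (n := n + y)).le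
  calc ‖mFourierCoeff f n‖ * ‖mFourier (n + y) t‖ ≤ ‖mFourierCoeff f n‖ * 1 :=
        mul_le_mul_of_nonneg_left h1 (norm_nonneg _)
    _ = ‖mFourierCoeff f n‖ := mul_one _

/-- the translation map `m ↦ x + N m` is injective for `N ≥ 1`. [folklore] -/
theorem translate_injective {N : ℕ} (hN : 1 ≤ N) (x : Fin (d + 1) → ℤ) :
    Function.Injective (translate N x) := by
  intro m m' h
  funext i
  have hi := congrFun h i
  simp only [translate_apply, add_right_inj] at hi
  have hN0 : (N : ℤ) ≠ 0 := by exact_mod_cast (show N ≠ 0 by omega)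
  exact mul_left_cancel₀ hN0 hi

/-- POISSON SUMMATION ON THE DISCRETE TORUS. For `f ∈ C((ℝ/ℤ)^{d+1}, ℂ)` with absolutely summable Fourier
coefficients `ĉ = mFourierCoeff f` and `N ≥ 1`:
`Σ_{k ∈ (ℤ/N)^{d+1}} f(k/N) Π_i e^{2πi x_i k_i/N} = N^{d+1} Σ_{m ∈ ℤ^{d+1}} ĉ(-x + Nm)`. [folklore: finite-group
Fourier inversion on `(ℤ/N)^{d+1}` combined with the pointwise convergent Fourier series of `f`] -/
theorem torusSum_eq_periodise (f : C(UnitAddTorus (Fin (d + 1)), ℂ)) (hs : Summable (mFourierCoeff f))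
    {N : ℕ} (hN : 1 ≤ N) (x : Fin (d + 1) → ℤ) :
    torusSum f N x = (N : ℂ) ^ (d + 1) * ∑' m : Fin (d + 1) → ℤ, mFourierCoeff f (translate N (-x) m) := by
  classical
  have hpt : ∀ t, ∑' n, mFourierCoeff f n * mFourier n t = f t := fun t => by
    simpa [smul_eq_mul] using (hasSum_mFourier_series_apply_of_summable hs t).tsum_eq
  have hsum0 : ∀ t, Summable (fun n => mFourierCoeff f n * mFourier n t) := fun t => by
    simpa using summable_coeff_mul_mFourier f hs 0 t
  have step1 : ∀ k : Fin (d + 1) → Fin N, f (gridPt N k) * mFourier x (gridPt N k)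
      = ∑' n, mFourierCoeff f n * mFourier (n + x) (gridPt N k) := by
    intro k
    rw [← hpt (gridPt N k), ← (hsum0 _).tsum_mul_right]
    exact tsum_congr fun n => by rw [mul_assoc, ← mFourier_add]
  have step2 : ∀ n : Fin (d + 1) → ℤ,
      ∑ k : Fin (d + 1) → Fin N, mFourierCoeff f n * mFourier (n + x) (gridPt N k)
        = (N : ℂ) ^ (d + 1) * (if ∀ i, (N : ℤ) ∣ n i + x i then mFourierCoeff f n else 0) := by
    intro n
    rw [← Finset.mul_sum, sum_mFourier_grid hN (n + x)]
    simp only [Pi.add_apply]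
    split_ifs <;> ring
  unfold torusSum
  simp_rw [step1]
  rw [← Summable.tsum_finsetSum (fun k _ => summable_coeff_mul_mFourier f hs x (gridPt N k))]
  simp_rw [step2]
  rw [tsum_mul_left]
  congr 1
  have hinj := translate_injective hN (-x)
  have hsupp : Function.support (fun n : Fin (d + 1) → ℤ =>
      if ∀ i, (N : ℤ) ∣ n i + x i then mFourierCoeff f n else 0) ⊆ Set.range (translate N (-x)) := by
    intro n hn
    rw [Function.mem_support] at hn
    have hP : ∀ i, (N : ℤ) ∣ n i + x i := by
      by_contra h
      exact hn (if_neg h)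
    choose c hc using hP
    refine ⟨c, funext fun i => ?_⟩
    simp only [translate_apply, Pi.neg_apply]
    linarith [hc i]
  rw [← hinj.tsum_eq hsupp]
  refine tsum_congr fun m => ?_
  have hP : ∀ i, (N : ℤ) ∣ translate N (-x) m i + x i := fun i => ⟨m i, by simp⟩
  simp only [if_pos hP]

/-! ### §5. The torus kernel of a multiplier with exponentially decaying lattice kernel -/

/-- the sup norm is even. [folklore] -/
theorem supNorm_neg (x : Fin (d + 1) → ℤ) : supNorm (-x) = supNorm x := by
  unfold supNorm
  simp only [Pi.neg_apply, abs_neg]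

/-- period `1`, base point `0`: the translate is the identity. [folklore] -/
@[simp] theorem translate_one_zero (m : Fin (d + 1) → ℤ) : translate 1 0 m = m := by
  funext i; simp

/-- exponential decay in the sup norm implies absolute summability over `ℤ^{d+1}`. [folklore] -/
theorem summable_of_decay (c : (Fin (d + 1) → ℤ) → ℂ) {κ M : ℝ} (hκ : 0 < κ)
    (hc : ∀ n, ‖c n‖ ≤ M * Real.exp (-(κ * supNorm n))) : Summable c := by
  have h := (periodise_bound c hκ hc (le_refl 1) 0 (fun i => by simp)).1
  simpa using h

/-- the (normalised) TORUS KERNEL of the grid samples of `f`: `N^{-(d+1)} Σ_{k ∈ (ℤ/N)^{d+1}} f(k/N) Π_i e^{2πi x_i k_i/N}` —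
for `f(t) = G(2πt)` this is the inverse finite Fourier transform (1.29) of B5 p. 23 of the multiplier `G` on the dual torus
`p_μ = 2π k_μ/N` of the unit-lattice torus with `N` sites per direction, evaluated at the lattice vector `x`. [cite: Balaban1984PropagatorsI, p. 23 (1.29), dictionary] [folklore] -/
def torusKernel (f : C(UnitAddTorus (Fin (d + 1)), ℂ)) (N : ℕ) (x : Fin (d + 1) → ℤ) : ℂ :=
  ((N : ℂ) ^ (d + 1))⁻¹ * torusSum f N x

/-- TORUS KERNEL = PERIODISED LATTICE KERNEL: `K_N(x) = Σ_{m ∈ ℤ^{d+1}} ĉ(-x + Nm)` ["relating G on the torus to G on the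
whole lattice … in the usual way", cite: Balaban1984PropagatorsI, p. 36 l. 20–23] [folklore] -/
theorem torusKernel_eq_periodise (f : C(UnitAddTorus (Fin (d + 1)), ℂ)) (hs : Summable (mFourierCoeff f))
    {N : ℕ} (hN : 1 ≤ N) (x : Fin (d + 1) → ℤ) :
    torusKernel f N x = ∑' m : Fin (d + 1) → ℤ, mFourierCoeff f (translate N (-x) m) := by
  have hN0 : (N : ℂ) ^ (d + 1) ≠ 0 := pow_ne_zero _ (by exact_mod_cast (show N ≠ 0 by omega))
  rw [torusKernel, torusSum_eq_periodise f hs hN x, ← mul_assoc, inv_mul_cancel₀ hN0, one_mul]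

/-- UNIFORM-IN-`N` DECAY OF THE TORUS KERNEL. If the Fourier coefficients (= the `ℤ^{d+1}`-lattice kernel) satisfy
`‖ĉ(n)‖ ≤ M e^{-κ|n|_∞}` with `κ > 0`, then for every period `N ≥ 1` and every centred representative `x` (`2|x_i| ≤ N`) the
torus kernel obeys `‖K_N(x)‖ ≤ M · C(κ,d) · e^{-(κ/(d+1))|x|_∞}` with `C(κ,d) = periodConst κ d` independent of `N` — i.e. decay
in the torus distance `dist_∞(x, Nℤ^{d+1}) = |x|_∞` at the rate `κ/(d+1)`, constants depending on `κ, d` only.  [the typed form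
of QGGQ-strip-census.md §3 "Unit torus … its kernel is the periodization Σ_n K_N(y + ℓn) … = Poisson summation"] [folklore] -/
theorem torusKernel_decay (f : C(UnitAddTorus (Fin (d + 1)), ℂ)) {κ M : ℝ} (hκ : 0 < κ)
    (hdec : ∀ n, ‖mFourierCoeff f n‖ ≤ M * Real.exp (-(κ * supNorm n))) {N : ℕ} (hN : 1 ≤ N)
    (x : Fin (d + 1) → ℤ) (hx : ∀ i, 2 * |x i| ≤ N) :
    ‖torusKernel f N x‖ ≤ M * periodConst κ d * Real.exp (-(κ / (d + 1) * supNorm x)) := by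
  have hs : Summable (mFourierCoeff f) := summable_of_decay _ hκ hdec
  rw [torusKernel_eq_periodise f hs hN x]
  have hx' : ∀ i, 2 * |(-x) i| ≤ (N : ℤ) := fun i => by simpa using hx i
  have h := periodise_bound_supNorm (mFourierCoeff f) hκ hdec hN (-x) hx'
  rwa [supNorm_neg] at h

open _root_.Topology
open scoped Pointwise

/-! ### §6. The dictionary: a strip-regular multiplier `G` read on the unit torus, `f(t) = G(2π t)`, and `ĉ(n) = K(−n)`

For `G` strip regular (`B4ContourShift.StripRegular G κ M`, `κ ≥ 0`) the function `s ↦ G(2πs)` on the closed box `[-1/2,1/2]^{d+1}`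
takes equal values on opposite faces (`StripRegular.sides` at `Im = 0`), hence descends to a continuous function on the torus
`(ℝ/ℤ)^{d+1}`; its Fourier coefficients are the lattice kernel, `ĉ(n) = latticeKernel G (−n)` (the substitution `p = 2πt` in
`UnitAddTorus.mFourierCoeff_eq_integral`), so `latticeKernel_decay` feeds `torusKernel_decay`. -/

/-- FACE MATCHING on the real Brillouin zone: two real momenta of `[-π,π]^{d+1}` that agree off a set `J` of coordinates and
sit on the opposite faces `-π` / `π` on `J` give the same value of a strip-regular `G` (the side condition, one coordinate at a
time). [folklore] -/
theorem face_match {G : (Fin (d + 1) → ℂ) → ℂ} {κ M : ℝ} (h : StripRegular G κ M) (hκ : 0 ≤ κ)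
    (J : Finset (Fin (d + 1))) :
    ∀ u v : Fin (d + 1) → ℝ, u ∈ BZ (d + 1) → v ∈ BZ (d + 1) → (∀ i, i ∉ J → u i = v i) →
      (∀ i ∈ J, u i = -π ∧ v i = π) → G (ofRealVec u) = G (ofRealVec v) := by
  classical
  induction J using Finset.induction_on with
  | empty =>
    intro u v _ _ hoff _
    have : u = v := funext fun i => hoff i (by simp)
    rw [this]
  | insert i J hi ih =>
    intro u v hu hv hoff hon
    have hui : u i = -π := (hon i (Finset.mem_insert_self i J)).1
    have hvi : v i = π := (hon i (Finset.mem_insert_self i J)).2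
    set u' : Fin (d + 1) → ℝ := Function.update u i π with hu'
    have hq : i.removeNth u ∈ BZ d := ⟨fun j => hu.1 (i.succAbove j), fun j => hu.2 (i.succAbove j)⟩
    have hu'BZ : u' ∈ BZ (d + 1) := by
      refine ⟨fun j => ?_, fun j => ?_⟩
      · by_cases hji : j = i
        · subst hji; simp [hu', Real.pi_pos.le]
        · rw [hu', Function.update_of_ne hji]; exact hu.1 j
      · by_cases hji : j = i
        · subst hji; simp [hu']
        · rw [hu', Function.update_of_ne hji]; exact hu.2 j
    have step : G (ofRealVec u) = G (ofRealVec u') := by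
      have e1 : u = i.insertNth (-π) (i.removeNth u) := by
        conv_lhs => rw [← Fin.insertNth_self_removeNth i u]
        rw [hui]
      have e2 : u' = i.insertNth π (i.removeNth u) := by
        rw [hu', Fin.insertNth_removeNth]
      rw [e1, e2, ofRealVec_insertNth, ofRealVec_insertNth]
      have hs := h.sides i (i.removeNth u) hq 0 (by simpa using hκ)
      simpa using hs
    rw [step]
    refine ih u' v hu'BZ hv ?_ ?_
    · intro j hj
      by_cases hji : j = i
      · subst hji; simp [hu', hvi]
      · rw [hu', Function.update_of_ne hji]
        exact hoff j (by simp [hji, hj])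
    · intro j hj
      have hji : j ≠ i := fun e => hi (e ▸ hj)
      rw [hu', Function.update_of_ne hji]
      exact hon j (Finset.mem_insert_of_mem hj)

/-- the centred representative in `[-1/2, 1/2)` of a point of `ℝ/ℤ` — on the torus of B5 (1.29), `p_μ = (π/L′_μ) n_μ` with
`−L′_μ ≤ n_μ < L′_μ`, i.e. `p_μ/2π ∈ [-1/2, 1/2)`. [folklore] -/
def rep (t : UnitAddCircle) : ℝ := (AddCircle.equivIco (1 : ℝ) (-(1 / 2 : ℝ)) t : ℝ)

/-- the representative lies in `[-1/2, 1/2)`. [folklore] -/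
theorem rep_mem (t : UnitAddCircle) : rep t ∈ Ico (-(1 / 2 : ℝ)) (1 / 2) := by
  have h := (AddCircle.equivIco (1 : ℝ) (-(1 / 2 : ℝ)) t).2
  refine ⟨h.1, ?_⟩
  have h2 := h.2
  show (AddCircle.equivIco (1 : ℝ) (-(1 / 2 : ℝ)) t : ℝ) < 1 / 2
  linarith

/-- a real number of `[-1/2, 1/2)` is its own representative. [folklore] -/
theorem rep_coe {s : ℝ} (hs : s ∈ Ico (-(1 / 2 : ℝ)) (1 / 2)) : rep (s : UnitAddCircle) = s := by
  have hs' : s ∈ Ico (-(1 / 2 : ℝ)) (-(1 / 2 : ℝ) + 1) := by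
    have e : (-(1 / 2 : ℝ)) + 1 = 1 / 2 := by norm_num
    rw [e]; exact hs
  unfold rep
  rw [AddCircle.equivIco_coe_eq hs']

/-- the representative of the far face `1/2` is the near face `-1/2`. [folklore] -/
theorem rep_coe_half : rep ((1 / 2 : ℝ) : UnitAddCircle) = -(1 / 2) := by
  have e1 : (((1 / 2 : ℝ) : ℝ) : UnitAddCircle) = (((-(1 / 2) + 1 : ℝ)) : UnitAddCircle) := by norm_num
  have e : (((1 / 2 : ℝ) : ℝ) : UnitAddCircle) = (((-(1 / 2) : ℝ)) : UnitAddCircle) := by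
    rw [e1, AddCircle.coe_add_period]
  rw [e, rep_coe (by norm_num)]

/-- `G` READ ON THE UNIT TORUS: `f(t) = G(2π · rep t)`, i.e. the multiplier at the dual-torus momentum `p = 2π rep(t) ∈ [-π, π)^{d+1}`.
[cite: Balaban1984PropagatorsI, p. 23 (1.29), dictionary] [folklore] -/
def descend (G : (Fin (d + 1) → ℂ) → ℂ) (t : UnitAddTorus (Fin (d + 1))) : ℂ :=
  G (ofRealVec (fun i => 2 * π * rep (t i)))

/-- the closed unit box `[-1/2, 1/2]^{d+1}`. [folklore] -/
def unitBox (d : ℕ) : Set (Fin (d + 1) → ℝ) := Icc (fun _ => -(1 / 2 : ℝ)) (fun _ => 1 / 2)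

/-- `2π ·` maps the unit box into the Brillouin zone. [folklore] -/
theorem two_pi_mul_mem_BZ {s : Fin (d + 1) → ℝ} (hs : s ∈ unitBox d) : (fun i => 2 * π * s i) ∈ BZ (d + 1) :=
  ⟨fun i => by have := hs.1 i; simp only at this ⊢; nlinarith [Real.pi_pos],
   fun i => by have := hs.2 i; simp only at this ⊢; nlinarith [Real.pi_pos]⟩

/-- ON THE CLOSED BOX the descent agrees with `s ↦ G(2πs)` — including the far faces `s_i = 1/2`, by face matching. [folklore] -/
theorem descend_coe {G : (Fin (d + 1) → ℂ) → ℂ} {κ M : ℝ} (h : StripRegular G κ M) (hκ : 0 ≤ κ)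
    {s : Fin (d + 1) → ℝ} (hs : s ∈ unitBox d) :
    descend G (fun i => ((s i : ℝ) : UnitAddCircle)) = G (ofRealVec (fun i => 2 * π * s i)) := by
  classical
  unfold descend
  set J : Finset (Fin (d + 1)) := Finset.univ.filter (fun i => s i = 1 / 2) with hJ
  refine face_match h hκ J _ _ ?_ (two_pi_mul_mem_BZ hs) ?_ ?_
  · refine ⟨fun i => ?_, fun i => ?_⟩
    · have := (rep_mem ((s i : ℝ) : UnitAddCircle)).1; simp only; nlinarith [Real.pi_pos]
    · have := (rep_mem ((s i : ℝ) : UnitAddCircle)).2; simp only; nlinarith [Real.pi_pos]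
  · intro i hi
    have hne : s i ≠ 1 / 2 := by simpa [hJ] using hi
    have hsi : s i ∈ Ico (-(1 / 2 : ℝ)) (1 / 2) := ⟨hs.1 i, lt_of_le_of_ne (hs.2 i) hne⟩
    simp only [rep_coe hsi]
  · intro i hi
    have hsi : s i = 1 / 2 := by simpa [hJ] using hi
    simp only [hsi, rep_coe_half]
    constructor <;> ring

/-- CONTINUITY OF THE DESCENT: the box `[-1/2,1/2]^{d+1}` is compact, the torus Hausdorff, so `s ↦ (s_i mod 1)_i` is a quotient
map, and `descend G` pulled back to the box is the continuous `s ↦ G(2πs)`. [folklore] -/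
theorem continuous_descend {G : (Fin (d + 1) → ℂ) → ℂ} {κ M : ℝ} (h : StripRegular G κ M) (hκ : 0 ≤ κ) :
    Continuous (descend G) := by
  let πB : unitBox d → UnitAddTorus (Fin (d + 1)) := fun s i => (((s : Fin (d + 1) → ℝ) i : ℝ) : UnitAddCircle)
  have hπc : Continuous πB := by
    apply continuous_pi
    intro i
    exact (AddCircle.continuous_mk' (1 : ℝ)).comp ((continuous_apply i).comp continuous_subtype_val)
  haveI : CompactSpace (unitBox d) := isCompact_iff_compactSpace.mp isCompact_Icc
  have hsurj : Function.Surjective πB := by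
    intro t
    refine ⟨⟨fun i => rep (t i), ⟨fun i => (rep_mem _).1, fun i => (rep_mem _).2.le⟩⟩, ?_⟩
    funext i
    exact AddCircle.coe_equivIco
  have hq : IsQuotientMap πB := hπc.isClosedMap.isQuotientMap hπc hsurj
  rw [hq.continuous_iff]
  have hcomp : descend G ∘ πB = G ∘ (fun s : unitBox d => ofRealVec (fun i => 2 * π * (s : Fin (d + 1) → ℝ) i)) := by
    funext s
    exact descend_coe h hκ s.2
  rw [hcomp]
  refine h.cont.comp_continuous ?_ ?_
  · exact continuous_ofRealVec.comp
      (continuous_pi fun i => continuous_const.mul ((continuous_apply i).comp continuous_subtype_val))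
  · intro s
    exact ofRealVec_mem_Strip hκ (two_pi_mul_mem_BZ s.2)

/-- the descent as an element of `C((ℝ/ℤ)^{d+1}, ℂ)`. [folklore] -/
def descendC (G : (Fin (d + 1) → ℂ) → ℂ) {κ M : ℝ} (h : StripRegular G κ M) (hκ : 0 ≤ κ) :
    C(UnitAddTorus (Fin (d + 1)), ℂ) :=
  ⟨descend G, continuous_descend h hκ⟩

/-- pointwise, `descendC` is `descend`. [folklore] -/
@[simp] theorem descendC_apply (G : (Fin (d + 1) → ℂ) → ℂ) {κ M : ℝ} (h : StripRegular G κ M) (hκ : 0 ≤ κ)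
    (t : UnitAddTorus (Fin (d + 1))) : descendC G h hκ t = descend G t := rfl

/-- THE GRID SAMPLES are the multiplier at the dual-torus momenta: `f(k/N) = G(2π rep(k/N))`, `2π rep(k_i/N) ∈ (2π/N)ℤ ∩ [-π, π)`.
[cite: Balaban1984PropagatorsI, p. 23 (1.29), dictionary] [folklore] -/
theorem descend_gridPt (G : (Fin (d + 1) → ℂ) → ℂ) (N : ℕ) (k : Fin (d + 1) → Fin N) :
    descend G (gridPt N k) = G (ofRealVec (fun i => 2 * π * rep ((((k i : ℕ) : ℝ) / N : ℝ) : UnitAddCircle))) := rfl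

/-- the character of the torus at a real lift is the phase of the lattice kernel at `p = 2πx`:
`Π_i e^{2πi n_i x_i} = e^{i (2πx)·n}`. [folklore] -/
theorem mFourier_coe_eq (n : Fin (d + 1) → ℤ) (x : Fin (d + 1) → ℝ) :
    mFourier n (fun i => ((x i : ℝ) : UnitAddCircle)) = cexp (I * phase ((2 * π) • x) n) := by
  show (∏ i, fourier (n i) ((x i : ℝ) : UnitAddCircle)) = cexp (I * phase ((2 * π) • x) n)
  rw [phase, Finset.mul_sum, Complex.exp_sum]
  refine Finset.prod_congr rfl fun i _ => ?_
  rw [fourier_coe_apply]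
  congr 1
  simp only [Pi.smul_apply, smul_eq_mul]
  push_cast
  ring

/-- THE FOURIER COEFFICIENTS OF THE DESCENT ARE THE LATTICE KERNEL: `ĉ(n) = (2π)^{-(d+1)} ∫_{[-π,π]^{d+1}} G(p) e^{-ip·n} dp
= latticeKernel G (−n)` (substitution `p = 2πt` in `UnitAddTorus.mFourierCoeff_eq_integral`; the half-open cell and the closed
box differ by a null set). [folklore] -/
theorem mFourierCoeff_descend {G : (Fin (d + 1) → ℂ) → ℂ} {κ M : ℝ} (h : StripRegular G κ M) (hκ : 0 ≤ κ)
    (n : Fin (d + 1) → ℤ) : mFourierCoeff (descendC G h hκ) n = latticeKernel G (-n) := by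
  rw [UnitAddTorus.mFourierCoeff_eq_integral _ n (fun _ => -(1 / 2 : ℝ))]
  have hS : {x : Fin (d + 1) → ℝ | ∀ i, x i ∈ Ioc (-(1 / 2 : ℝ)) (-(1 / 2 : ℝ) + 1)}
      = Set.pi univ (fun _ => Ioc (-(1 / 2 : ℝ)) (1 / 2)) := by
    ext x
    simp only [Set.mem_setOf_eq, Set.mem_univ_pi]
    have e : (-(1 / 2 : ℝ)) + 1 = 1 / 2 := by norm_num
    rw [e]
  have hEq : EqOn
      (fun x : Fin (d + 1) → ℝ => mFourier (-n) (fun i => ((x i : ℝ) : UnitAddCircle)) •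
        (descendC G h hκ) (fun i => ((x i : ℝ) : UnitAddCircle)))
      (fun x => integrand G (-n) ((2 * π) • x)) (Set.pi univ (fun _ => Ioc (-(1 / 2 : ℝ)) (1 / 2))) := by
    intro x hx
    have hx' : x ∈ unitBox d :=
      ⟨fun i => ((Set.mem_univ_pi.mp hx) i).1.le, fun i => ((Set.mem_univ_pi.mp hx) i).2⟩
    simp only [descendC_apply, smul_eq_mul]
    rw [descend_coe h hκ hx', mFourier_coe_eq, integrand, mul_comm]
    rfl
  rw [hS, setIntegral_congr_fun (MeasurableSet.univ_pi fun _ => measurableSet_Ioc) hEq,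
    Measure.setIntegral_comp_smul_of_pos volume (fun p => integrand G (-n) p) _ (by positivity : (0 : ℝ) < 2 * π)]
  have hset : (2 * π) • (Set.pi univ (fun _ : Fin (d + 1) => Ioc (-(1 / 2 : ℝ)) (1 / 2)))
      = Set.pi univ (fun _ => Ioc (-π) π) := by
    ext p
    rw [Set.mem_smul_set_iff_inv_smul_mem₀ (by positivity : (2 * π : ℝ) ≠ 0)]
    simp only [Set.mem_univ_pi, Pi.smul_apply, smul_eq_mul, Set.mem_Ioc]
    refine forall_congr' fun i => ?_
    rw [inv_mul_eq_div, lt_div_iff₀ (by positivity : (0 : ℝ) < 2 * π), div_le_iff₀ (by positivity : (0 : ℝ) < 2 * π)]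
    constructor <;> rintro ⟨h1, h2⟩ <;> constructor <;> linarith
  rw [hset, Module.finrank_fin_fun,
    setIntegral_congr_set (show Set.pi univ (fun _ : Fin (d + 1) => Ioc (-π) π) =ᵐ[volume] BZ (d + 1) from by
      rw [volume_pi]; exact Measure.univ_pi_Ioc_ae_eq_Icc)]
  rfl

/-- hence the coefficients of the descent DECAY like the lattice kernel: `‖ĉ(n)‖ ≤ M e^{-κ|n|_∞}`. [folklore] -/
theorem norm_mFourierCoeff_descend_le {G : (Fin (d + 1) → ℂ) → ℂ} {κ M : ℝ} (h : StripRegular G κ M) (hκ : 0 ≤ κ)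
    (n : Fin (d + 1) → ℤ) : ‖mFourierCoeff (descendC G h hκ) n‖ ≤ M * Real.exp (-(κ * supNorm n)) := by
  rw [mFourierCoeff_descend h hκ n, ← supNorm_neg n]
  exact latticeKernel_decay h hκ (-n)

/-- TORUS KERNEL OF A STRIP-REGULAR MULTIPLIER = PERIODISED LATTICE KERNEL:
`N^{-(d+1)} Σ_{k ∈ (ℤ/N)^{d+1}} G(2π rep(k/N)) e^{2πi k·x/N} = Σ_{m ∈ ℤ^{d+1}} K(x + Nm)`, `K = latticeKernel G`, for `κ > 0`,
`N ≥ 1`. [cite: Balaban1984PropagatorsI, p. 36 l. 20–23 "relating G on the torus to G on the whole lattice … in the usual way"]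
[folklore] -/
theorem torusKernel_descend_eq {G : (Fin (d + 1) → ℂ) → ℂ} {κ M : ℝ} (h : StripRegular G κ M) (hκ : 0 < κ)
    {N : ℕ} (hN : 1 ≤ N) (x : Fin (d + 1) → ℤ) :
    torusKernel (descendC G h hκ.le) N x = ∑' m : Fin (d + 1) → ℤ, latticeKernel G (translate N x m) := by
  have hs : Summable (mFourierCoeff (descendC G h hκ.le)) :=
    summable_of_decay _ hκ (norm_mFourierCoeff_descend_le h hκ.le)
  rw [torusKernel_eq_periodise _ hs hN x]
  simp_rw [mFourierCoeff_descend h hκ.le]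
  rw [← (Equiv.neg (Fin (d + 1) → ℤ)).tsum_eq]
  refine tsum_congr fun m => ?_
  congr 1
  funext i
  simp [translate, add_comm]

/-- UNIFORM-IN-`N` EXPONENTIAL DECAY OF THE TORUS KERNEL OF A STRIP-REGULAR MULTIPLIER (B5 (1.126) on the torus, the engine):
`StripRegular G κ M`, `κ > 0`, `N ≥ 1`, `x` a centred representative (`2|x_i| ≤ N`) ⇒
`‖N^{-(d+1)} Σ_k G(2π rep(k/N)) e^{2πi k·x/N}‖ ≤ M · periodConst κ d · e^{-(κ/(d+1))|x|_∞}`, constants depending on `κ, d` only.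
[cite: Balaban1984PropagatorsI, p. 38 (1.126) with p. 36 l. 20–23, dictionary] [folklore] -/
theorem torusKernel_descend_decay {G : (Fin (d + 1) → ℂ) → ℂ} {κ M : ℝ} (h : StripRegular G κ M) (hκ : 0 < κ)
    {N : ℕ} (hN : 1 ≤ N) (x : Fin (d + 1) → ℤ) (hx : ∀ i, 2 * |x i| ≤ N) :
    ‖torusKernel (descendC G h hκ.le) N x‖ ≤ M * periodConst κ d * Real.exp (-(κ / (d + 1) * supNorm x)) :=
  torusKernel_decay _ hκ (norm_mFourierCoeff_descend_le h hκ.le) hN x hx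

/-! ### §7. Unequal periods: the torus `Π_μ ℤ/N_μ` of B5 p. 17 (`−L_μ ≤ x_μ < L_μ`) and p. 23 (1.29) (`−L′_μ ≤ n_μ < L′_μ`)

The same statements for a period vector `N : Fin (d+1) → ℕ` (all `N_μ ≥ 1`): periodisation over the sublattice `Π_μ N_μℤ`,
Poisson summation on `Π_μ ℤ/N_μ`, and the decay of the torus kernel of a strip-regular multiplier at rate `κ/(d+1)` in the
torus distance with the constant `M · periodConst κ d` — uniform in the whole period vector.  The proofs are those of §3–§6
coordinate by coordinate (they were coordinatewise already); the equal-period declarations above are kept as they are. -/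

namespace MultiPeriod

/-- the translate `x + (N_μ m_μ)_μ` by the sublattice `Π_μ N_μ ℤ`. [folklore] -/
def translate (N : Fin (d + 1) → ℕ) (x m : Fin (d + 1) → ℤ) : Fin (d + 1) → ℤ := fun i => x i + N i * m i

/-- components of the translate. [folklore] -/
@[simp] theorem translate_apply (N : Fin (d + 1) → ℕ) (x m : Fin (d + 1) → ℤ) (i : Fin (d + 1)) :
    translate N x m i = x i + N i * m i := rfl

/-- termwise majorant, unequal periods: for `2|x_μ| ≤ N_μ` and `‖K y‖ ≤ M e^{-κ|y|_∞}`,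
`‖K(x + Nm)‖ ≤ M e^{κ'(d+1)} e^{-κ' Σ_μ |x_μ|} Π_μ (e^{-κ'})^{|m_μ|}`, `κ' = κ/(d+1)`. [folklore] -/
theorem norm_translate_le (K : (Fin (d + 1) → ℤ) → ℂ) {κ M : ℝ} (hκ : 0 ≤ κ)
    (hK : ∀ y, ‖K y‖ ≤ M * Real.exp (-(κ * supNorm y))) {N : Fin (d + 1) → ℕ} (hN : ∀ i, 1 ≤ N i)
    (x : Fin (d + 1) → ℤ) (hx : ∀ i, 2 * |x i| ≤ N i) (m : Fin (d + 1) → ℤ) :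
    ‖K (translate N x m)‖ ≤
      M * (Real.exp (κ / (d + 1)) ^ (d + 1) * Real.exp (-(κ / (d + 1) * ∑ i, |((x i : ℤ) : ℝ)|)))
        * ∏ i, Real.exp (-(κ / (d + 1))) ^ (m i).natAbs := by
  have hM : 0 ≤ M := by
    have h := hK 0
    nlinarith [norm_nonneg (K 0), Real.exp_pos (-(κ * supNorm (0 : Fin (d + 1) → ℤ)))]
  set κ' := κ / (d + 1) with hκ'
  have hκ'0 : 0 ≤ κ' := div_nonneg hκ (by positivity)
  have step : ∀ i, Real.exp (-(κ' * |((translate N x m i : ℤ) : ℝ)|))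
      ≤ Real.exp κ' * Real.exp (-(κ' * |((x i : ℤ) : ℝ)|)) * Real.exp (-κ') ^ (m i).natAbs := by
    intro i
    have := exp_translate_le hκ'0 (x i) (m i) (hN i) (hx i)
    simpa [translate] using this
  calc ‖K (translate N x m)‖ ≤ M * Real.exp (-(κ * supNorm (translate N x m))) := hK _
    _ ≤ M * ∏ i, Real.exp (-(κ' * |((translate N x m i : ℤ) : ℝ)|)) :=
        mul_le_mul_of_nonneg_left (exp_supNorm_le_prod hκ _) hM
    _ ≤ M * ∏ i, (Real.exp κ' * Real.exp (-(κ' * |((x i : ℤ) : ℝ)|)) * Real.exp (-κ') ^ (m i).natAbs) := by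
        apply mul_le_mul_of_nonneg_left _ hM
        exact Finset.prod_le_prod (fun i _ => (Real.exp_pos _).le) (fun i _ => step i)
    _ = M * (Real.exp κ' ^ (d + 1) * Real.exp (-(κ' * ∑ i, |((x i : ℤ) : ℝ)|)))
        * ∏ i, Real.exp (-κ') ^ (m i).natAbs := by
        rw [Finset.prod_mul_distrib, Finset.prod_mul_distrib, Finset.prod_const, Finset.card_univ,
          Fintype.card_fin, ← Real.exp_sum]
        have e : ∑ i, -(κ' * |((x i : ℤ) : ℝ)|) = -(κ' * ∑ i, |((x i : ℤ) : ℝ)|) := by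
          rw [Finset.mul_sum, ← Finset.sum_neg_distrib]
        rw [e]
        ring

/-- PERIODISATION BOUND, unequal periods `N_μ ≥ 1`, centred `x` (`2|x_μ| ≤ N_μ`):
`Σ_m K(x + Nm)` converges absolutely and `‖Σ_m K(x + Nm)‖ ≤ M·periodConst κ d·e^{-(κ/(d+1)) Σ_μ|x_μ|}` — the constant does not
depend on the period vector. [folklore] -/
theorem periodise_bound (K : (Fin (d + 1) → ℤ) → ℂ) {κ M : ℝ} (hκ : 0 < κ)
    (hK : ∀ y, ‖K y‖ ≤ M * Real.exp (-(κ * supNorm y))) {N : Fin (d + 1) → ℕ} (hN : ∀ i, 1 ≤ N i)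
    (x : Fin (d + 1) → ℤ) (hx : ∀ i, 2 * |x i| ≤ N i) :
    Summable (fun m : Fin (d + 1) → ℤ => K (translate N x m)) ∧
      ‖∑' m : Fin (d + 1) → ℤ, K (translate N x m)‖
        ≤ M * periodConst κ d * Real.exp (-(κ / (d + 1) * ∑ i, |((x i : ℤ) : ℝ)|)) := by
  set κ' := κ / (d + 1) with hκ'
  have hκ'pos : 0 < κ' := div_pos hκ (by positivity)
  set r := Real.exp (-κ') with hr
  have hr0 : 0 ≤ r := (Real.exp_pos _).le
  have hr1 : r < 1 := Real.exp_lt_one_iff.mpr (by linarith)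
  obtain ⟨hgs, hgle⟩ := summable_geometric_int hr0 hr1
  set A := M * (Real.exp κ' ^ (d + 1) * Real.exp (-(κ' * ∑ i, |((x i : ℤ) : ℝ)|))) with hA
  obtain ⟨hps, hpe⟩ := summable_prod_pi (k := d + 1) (fun _ j => r ^ j.natAbs)
    (fun _ j => pow_nonneg hr0 _) (fun _ => hgs)
  have hle : ∀ m : Fin (d + 1) → ℤ, ‖K (translate N x m)‖ ≤ A * ∏ i, r ^ (m i).natAbs :=
    fun m => norm_translate_le K hκ.le hK hN x hx m
  have hmaj : Summable (fun m : Fin (d + 1) → ℤ => A * ∏ i, r ^ (m i).natAbs) := hps.mul_left A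
  refine ⟨Summable.of_norm_bounded hmaj hle, ?_⟩
  have hM : 0 ≤ M := by
    have h := hK 0
    nlinarith [norm_nonneg (K 0), Real.exp_pos (-(κ * supNorm (0 : Fin (d + 1) → ℤ)))]
  have hA0 : 0 ≤ A := by positivity
  calc ‖∑' m : Fin (d + 1) → ℤ, K (translate N x m)‖
      ≤ ∑' m : Fin (d + 1) → ℤ, A * ∏ i, r ^ (m i).natAbs := tsum_of_norm_bounded hmaj.hasSum hle
    _ = A * (∑' j : ℤ, r ^ j.natAbs) ^ (d + 1) := by
        rw [tsum_mul_left, hpe, Finset.prod_const, Finset.card_univ, Fintype.card_fin]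
    _ ≤ A * (2 / (1 - r)) ^ (d + 1) := by
        apply mul_le_mul_of_nonneg_left _ hA0
        exact pow_le_pow_left₀ (tsum_nonneg fun j => pow_nonneg hr0 _) hgle _
    _ = M * periodConst κ d * Real.exp (-(κ / (d + 1) * ∑ i, |((x i : ℤ) : ℝ)|)) := by
        rw [hA, periodConst, ← hκ', div_pow, div_pow, mul_pow]
        ring

/-- the same bound in the sup norm: `‖Σ_m K(x + Nm)‖ ≤ M·periodConst κ d·e^{-(κ/(d+1))|x|_∞}`. [folklore] -/
theorem periodise_bound_supNorm (K : (Fin (d + 1) → ℤ) → ℂ) {κ M : ℝ} (hκ : 0 < κ)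
    (hK : ∀ y, ‖K y‖ ≤ M * Real.exp (-(κ * supNorm y))) {N : Fin (d + 1) → ℕ} (hN : ∀ i, 1 ≤ N i)
    (x : Fin (d + 1) → ℤ) (hx : ∀ i, 2 * |x i| ≤ N i) :
    ‖∑' m : Fin (d + 1) → ℤ, K (translate N x m)‖
      ≤ M * periodConst κ d * Real.exp (-(κ / (d + 1) * supNorm x)) := by
  refine le_trans (periodise_bound K hκ hK hN x hx).2 ?_
  have hM : 0 ≤ M := by
    have h := hK 0
    nlinarith [norm_nonneg (K 0), Real.exp_pos (-(κ * supNorm (0 : Fin (d + 1) → ℤ)))]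
  have hC : 0 ≤ periodConst κ d := by
    unfold periodConst
    apply pow_nonneg
    apply div_nonneg (by positivity)
    have : Real.exp (-(κ / (d + 1))) < 1 := Real.exp_lt_one_iff.mpr (by
      have : 0 < κ / (d + 1) := div_pos hκ (by positivity); linarith)
    linarith
  apply mul_le_mul_of_nonneg_left _ (mul_nonneg hM hC)
  apply Real.exp_le_exp.mpr
  obtain ⟨i, hi⟩ := exists_supNorm_eq x
  have : supNorm x ≤ ∑ j, |((x j : ℤ) : ℝ)| := by
    rw [hi, Int.cast_abs]
    exact Finset.single_le_sum (f := fun j => |((x j : ℤ) : ℝ)|) (fun j _ => abs_nonneg _) (Finset.mem_univ i)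
  have hκ' : 0 ≤ κ / (d + 1) := div_nonneg hκ.le (by positivity)
  nlinarith

/-- the grid point `(k_μ/N_μ)_μ` of the unit torus — dual-torus momentum `p_μ = 2πk_μ/N_μ` of B5 (1.29), `N_μ = 2L′_μ`.
[cite: Balaban1984PropagatorsI, p. 23 (1.29), dictionary] [folklore] -/
def gridPt (N : Fin (d + 1) → ℕ) (k : (i : Fin (d + 1)) → Fin (N i)) : UnitAddTorus (Fin (d + 1)) :=
  fun i => ((((k i : ℕ) : ℝ) / N i : ℝ) : UnitAddCircle)

/-- the discrete inverse Fourier transform of the grid samples (un-normalised), unequal periods: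
`Σ_{k ∈ Π_μ ℤ/N_μ} f(k/N) · Π_μ e^{2πi x_μ k_μ / N_μ}`. [cite: Balaban1984PropagatorsI, p. 23 (1.29), dictionary] [folklore] -/
def torusSum (f : C(UnitAddTorus (Fin (d + 1)), ℂ)) (N : Fin (d + 1) → ℕ) (x : Fin (d + 1) → ℤ) : ℂ :=
  ∑ k : (i : Fin (d + 1)) → Fin (N i), f (gridPt N k) * mFourier x (gridPt N k)

/-- character sum over the grid `Π_μ ℤ/N_μ`: `Σ_k Π_μ e^{2πi n_μ k_μ/N_μ} = Π_μ N_μ` if `N_μ ∣ n_μ` for all `μ`, else `0`. [folklore] -/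
theorem sum_mFourier_grid {N : Fin (d + 1) → ℕ} (hN : ∀ i, 1 ≤ N i) (n : Fin (d + 1) → ℤ) :
    ∑ k : (i : Fin (d + 1)) → Fin (N i), mFourier n (gridPt N k)
      = if ∀ i, (N i : ℤ) ∣ n i then ∏ i, ((N i : ℕ) : ℂ) else 0 := by
  classical
  have h1 : ∀ k : (i : Fin (d + 1)) → Fin (N i), mFourier n (gridPt N k)
      = ∏ i, fourier (n i) ((((k i : ℕ) : ℝ) / N i : ℝ) : UnitAddCircle) := fun k => rfl
  simp_rw [h1]
  rw [← Fintype.piFinset_univ, ← Finset.prod_univ_sum (fun i => (Finset.univ : Finset (Fin (N i))))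
    (fun i j => fourier (n i) ((((j : ℕ) : ℝ) / N i : ℝ) : UnitAddCircle))]
  simp_rw [sum_fourier_grid (hN _)]
  split_ifs with h
  · exact Finset.prod_congr rfl (fun i _ => if_pos (h i))
  · obtain ⟨i, hi⟩ := not_forall.mp h
    exact Finset.prod_eq_zero (Finset.mem_univ i) (if_neg hi)

/-- the translation map `m ↦ x + N m` is injective when all `N_μ ≥ 1`. [folklore] -/
theorem translate_injective {N : Fin (d + 1) → ℕ} (hN : ∀ i, 1 ≤ N i) (x : Fin (d + 1) → ℤ) :
    Function.Injective (translate N x) := by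
  intro m m' h
  funext i
  have hi := congrFun h i
  simp only [translate_apply, add_right_inj] at hi
  have hN0 : (N i : ℤ) ≠ 0 := by have := hN i; omega
  exact mul_left_cancel₀ hN0 hi

/-- POISSON SUMMATION ON `Π_μ ℤ/N_μ`: for `f ∈ C((ℝ/ℤ)^{d+1}, ℂ)` with `ĉ ∈ ℓ¹` and all `N_μ ≥ 1`,
`Σ_k f(k/N) Π_μ e^{2πi x_μ k_μ/N_μ} = (Π_μ N_μ) Σ_{m ∈ ℤ^{d+1}} ĉ(-x + Nm)`. [folklore] -/
theorem torusSum_eq_periodise (f : C(UnitAddTorus (Fin (d + 1)), ℂ)) (hs : Summable (mFourierCoeff f))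
    {N : Fin (d + 1) → ℕ} (hN : ∀ i, 1 ≤ N i) (x : Fin (d + 1) → ℤ) :
    torusSum f N x = (∏ i, ((N i : ℕ) : ℂ)) * ∑' m : Fin (d + 1) → ℤ, mFourierCoeff f (translate N (-x) m) := by
  classical
  have hpt : ∀ t, ∑' n, mFourierCoeff f n * mFourier n t = f t := fun t => by
    simpa [smul_eq_mul] using (hasSum_mFourier_series_apply_of_summable hs t).tsum_eq
  have hsum0 : ∀ t, Summable (fun n => mFourierCoeff f n * mFourier n t) := fun t => by
    simpa using summable_coeff_mul_mFourier f hs 0 t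
  have step1 : ∀ k : (i : Fin (d + 1)) → Fin (N i), f (gridPt N k) * mFourier x (gridPt N k)
      = ∑' n, mFourierCoeff f n * mFourier (n + x) (gridPt N k) := by
    intro k
    rw [← hpt (gridPt N k), ← (hsum0 _).tsum_mul_right]
    exact tsum_congr fun n => by rw [mul_assoc, ← mFourier_add]
  have step2 : ∀ n : Fin (d + 1) → ℤ,
      ∑ k : (i : Fin (d + 1)) → Fin (N i), mFourierCoeff f n * mFourier (n + x) (gridPt N k)
        = (∏ i, ((N i : ℕ) : ℂ)) * (if ∀ i, (N i : ℤ) ∣ n i + x i then mFourierCoeff f n else 0) := by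
    intro n
    rw [← Finset.mul_sum, sum_mFourier_grid hN (n + x)]
    simp only [Pi.add_apply]
    split_ifs <;> ring
  unfold torusSum
  simp_rw [step1]
  rw [← Summable.tsum_finsetSum (fun k _ => summable_coeff_mul_mFourier f hs x (gridPt N k))]
  simp_rw [step2]
  rw [tsum_mul_left]
  congr 1
  have hinj := translate_injective hN (-x)
  have hsupp : Function.support (fun n : Fin (d + 1) → ℤ =>
      if ∀ i, (N i : ℤ) ∣ n i + x i then mFourierCoeff f n else 0) ⊆ Set.range (translate N (-x)) := by
    intro n hn
    rw [Function.mem_support] at hn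
    have hP : ∀ i, (N i : ℤ) ∣ n i + x i := by
      by_contra h
      exact hn (if_neg h)
    choose c hc using hP
    refine ⟨c, funext fun i => ?_⟩
    simp only [translate_apply, Pi.neg_apply]
    linarith [hc i]
  rw [← hinj.tsum_eq hsupp]
  refine tsum_congr fun m => ?_
  have hP : ∀ i, (N i : ℤ) ∣ translate N (-x) m i + x i := fun i => ⟨m i, by simp⟩
  simp only [if_pos hP]

/-- the normalised TORUS KERNEL on `Π_μ ℤ/N_μ`: `(Π_μ N_μ)^{-1} Σ_k f(k/N) Π_μ e^{2πi x_μ k_μ/N_μ}`.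
[cite: Balaban1984PropagatorsI, p. 23 (1.29), dictionary] [folklore] -/
def torusKernel (f : C(UnitAddTorus (Fin (d + 1)), ℂ)) (N : Fin (d + 1) → ℕ) (x : Fin (d + 1) → ℤ) : ℂ :=
  (∏ i, ((N i : ℕ) : ℂ))⁻¹ * torusSum f N x

/-- torus kernel = periodised coefficient sequence, unequal periods. [cite: Balaban1984PropagatorsI, p. 36 l. 20–23] [folklore] -/
theorem torusKernel_eq_periodise (f : C(UnitAddTorus (Fin (d + 1)), ℂ)) (hs : Summable (mFourierCoeff f))
    {N : Fin (d + 1) → ℕ} (hN : ∀ i, 1 ≤ N i) (x : Fin (d + 1) → ℤ) :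
    torusKernel f N x = ∑' m : Fin (d + 1) → ℤ, mFourierCoeff f (translate N (-x) m) := by
  have hN0 : (∏ i, ((N i : ℕ) : ℂ)) ≠ 0 :=
    Finset.prod_ne_zero_iff.mpr fun i _ => by have := hN i; exact_mod_cast (show N i ≠ 0 by omega)
  rw [torusKernel, torusSum_eq_periodise f hs hN x, ← mul_assoc, inv_mul_cancel₀ hN0, one_mul]

/-- UNIFORM DECAY OF THE TORUS KERNEL, unequal periods: `‖ĉ(n)‖ ≤ M e^{-κ|n|_∞}`, `κ > 0`, all `N_μ ≥ 1`, `2|x_μ| ≤ N_μ` ⇒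
`‖K_N(x)‖ ≤ M · periodConst κ d · e^{-(κ/(d+1))|x|_∞}`, constants depending on `κ, d` only. [folklore] -/
theorem torusKernel_decay (f : C(UnitAddTorus (Fin (d + 1)), ℂ)) {κ M : ℝ} (hκ : 0 < κ)
    (hdec : ∀ n, ‖mFourierCoeff f n‖ ≤ M * Real.exp (-(κ * supNorm n))) {N : Fin (d + 1) → ℕ} (hN : ∀ i, 1 ≤ N i)
    (x : Fin (d + 1) → ℤ) (hx : ∀ i, 2 * |x i| ≤ N i) :
    ‖torusKernel f N x‖ ≤ M * periodConst κ d * Real.exp (-(κ / (d + 1) * supNorm x)) := by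
  have hs : Summable (mFourierCoeff f) := summable_of_decay _ hκ hdec
  rw [torusKernel_eq_periodise f hs hN x]
  have hx' : ∀ i, 2 * |(-x) i| ≤ (N i : ℤ) := fun i => by simpa using hx i
  have h := periodise_bound_supNorm (mFourierCoeff f) hκ hdec hN (-x) hx'
  rwa [supNorm_neg] at h

/-- the grid samples of the descent are the multiplier at the dual-torus momenta `2π rep(k_μ/N_μ)`. [folklore] -/
theorem descend_gridPt (G : (Fin (d + 1) → ℂ) → ℂ) (N : Fin (d + 1) → ℕ) (k : (i : Fin (d + 1)) → Fin (N i)) :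
    descend G (gridPt N k) = G (ofRealVec (fun i => 2 * π * rep ((((k i : ℕ) : ℝ) / N i : ℝ) : UnitAddCircle))) := rfl

/-- TORUS KERNEL OF A STRIP-REGULAR MULTIPLIER = PERIODISED LATTICE KERNEL, unequal periods:
`(Π_μ N_μ)^{-1} Σ_k G(2π rep(k/N)) e^{2πi Σ_μ k_μ x_μ/N_μ} = Σ_m latticeKernel G (x + Nm)`. [cite: Balaban1984PropagatorsI,
p. 36 l. 20–23] [folklore] -/
theorem torusKernel_descend_eq {G : (Fin (d + 1) → ℂ) → ℂ} {κ M : ℝ} (h : StripRegular G κ M) (hκ : 0 < κ)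
    {N : Fin (d + 1) → ℕ} (hN : ∀ i, 1 ≤ N i) (x : Fin (d + 1) → ℤ) :
    torusKernel (descendC G h hκ.le) N x = ∑' m : Fin (d + 1) → ℤ, latticeKernel G (translate N x m) := by
  have hs : Summable (mFourierCoeff (descendC G h hκ.le)) :=
    summable_of_decay _ hκ (norm_mFourierCoeff_descend_le h hκ.le)
  rw [torusKernel_eq_periodise _ hs hN x]
  simp_rw [mFourierCoeff_descend h hκ.le]
  rw [← (Equiv.neg (Fin (d + 1) → ℤ)).tsum_eq]
  refine tsum_congr fun m => ?_
  congr 1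
  funext i
  simp [translate, add_comm]

/-- UNIFORM EXPONENTIAL DECAY OF THE TORUS KERNEL OF A STRIP-REGULAR MULTIPLIER ON `Π_μ ℤ/N_μ` (B5's torus
`−L_μ ≤ x_μ < L_μ`, p. 17, with `N_μ = 2L_μ`): `StripRegular G κ M`, `κ > 0`, all `N_μ ≥ 1`, `2|x_μ| ≤ N_μ` ⇒
`‖torusKernel (descendC G h _) N x‖ ≤ M · periodConst κ d · e^{-(κ/(d+1))|x|_∞}` — uniform in the period vector.
[cite: Balaban1984PropagatorsI, p. 38 (1.126) with p. 36 l. 20–23, dictionary] [folklore] -/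
theorem torusKernel_descend_decay {G : (Fin (d + 1) → ℂ) → ℂ} {κ M : ℝ} (h : StripRegular G κ M) (hκ : 0 < κ)
    {N : Fin (d + 1) → ℕ} (hN : ∀ i, 1 ≤ N i) (x : Fin (d + 1) → ℤ) (hx : ∀ i, 2 * |x i| ≤ N i) :
    ‖torusKernel (descendC G h hκ.le) N x‖ ≤ M * periodConst κ d * Real.exp (-(κ / (d + 1) * supNorm x)) :=
  torusKernel_decay _ hκ (norm_mFourierCoeff_descend_le h hκ.le) hN x hx

/-- consistency with the equal-period declarations: for the constant period vector the two torus kernels agree. [folklore] -/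
theorem torusKernel_const (f : C(UnitAddTorus (Fin (d + 1)), ℂ)) (N : ℕ) (x : Fin (d + 1) → ℤ) :
    torusKernel f (fun _ => N) x = B4TorusKernel.torusKernel f N x := by
  unfold torusKernel torusSum B4TorusKernel.torusKernel B4TorusKernel.torusSum
  rw [Finset.prod_const, Finset.card_univ, Fintype.card_fin]
  rfl

/-! ### §8. The torus metric (v4): `N_μ`-periodicity of the torus kernel and decay at EVERY lattice point in the sup-distance of
the class of `x` to `0` in `Π_μ ℤ/N_μ`

The grid characters `x ↦ Π_μ e^{2πi x_μ k_μ/N_μ}` are `N_μ`-periodic in `x_μ`, hence so is `MultiPeriod.torusKernel f N`; every class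
`x + Π_μ N_μℤ` has a centred representative `x₀` (`2|x₀_μ| ≤ N_μ`) with `|x₀_μ| = dist(x_μ, N_μℤ)`; so the centred statements of §5–§7 give,
for an ARBITRARY `x ∈ ℤ^{d+1}`, decay in `torusSupNorm N x = max_μ dist(x_μ, N_μℤ)` — the sup-distance on the torus `Π_μ ℤ/N_μ` between
the classes of `x` and `0` (for a difference `x = y − y′`: between `y` and `y′`).  This is the form in which kernel-by-kernel consumers read
"exponential decay … with distances in the torus metric" (cell records GAPS G-pv07-2 (b), G-B5-19). [folklore] -/

/-- the distance from `x ∈ ℤ` to `Nℤ`: `min (x mod N, N − x mod N)` (`N ≥ 1`; values in `[0, N/2]`). [folklore] -/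
def circAbs (N : ℕ) (x : ℤ) : ℤ := min (x % (N : ℤ)) ((N : ℤ) - x % (N : ℤ))

/-- the centring translation: `x + N · centre N x` is the representative of `x mod N` in `[−N/2, N/2]` realising `circAbs`. [folklore] -/
def centre (N : ℕ) (x : ℤ) : ℤ := if 2 * (x % (N : ℤ)) ≤ N then -(x / (N : ℤ)) else -(x / (N : ℤ)) - 1

/-- `0 ≤ x mod N` for `N ≥ 1`. [folklore] -/
theorem emod_nonneg_of_one_le {N : ℕ} (hN : 1 ≤ N) (x : ℤ) : 0 ≤ x % (N : ℤ) := Int.emod_nonneg _ (by omega)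

/-- `x mod N < N` for `N ≥ 1`. [folklore] -/
theorem emod_lt_of_one_le {N : ℕ} (hN : 1 ≤ N) (x : ℤ) : x % (N : ℤ) < N := Int.emod_lt_of_pos _ (by omega)

/-- `0 ≤ circAbs N x`. [folklore] -/
theorem circAbs_nonneg {N : ℕ} (hN : 1 ≤ N) (x : ℤ) : 0 ≤ circAbs N x := by
  have h0 := emod_nonneg_of_one_le hN x
  have h1 := emod_lt_of_one_le hN x
  rw [circAbs, le_min_iff]
  omega

/-- `2 · circAbs N x ≤ N`. [folklore] -/
theorem two_mul_circAbs_le (N : ℕ) (x : ℤ) : 2 * circAbs N x ≤ N := by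
  have hl : circAbs N x ≤ x % (N : ℤ) := min_le_left _ _
  have hr : circAbs N x ≤ (N : ℤ) - x % (N : ℤ) := min_le_right _ _
  omega

/-- `circAbs` is `N`-periodic. [folklore] -/
theorem circAbs_add_mul (N : ℕ) (x m : ℤ) : circAbs N (x + N * m) = circAbs N x := by
  unfold circAbs
  rw [Int.add_mul_emod_self_left]

/-- the centring translation realises `circAbs`: `|x + N · centre N x| = circAbs N x`. [folklore] -/
theorem abs_add_mul_centre {N : ℕ} (hN : 1 ≤ N) (x : ℤ) : |x + N * centre N x| = circAbs N x := by
  have hdiv : (N : ℤ) * (x / (N : ℤ)) + x % (N : ℤ) = x := Int.mul_ediv_add_emod x (N : ℤ)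
  have h0 := emod_nonneg_of_one_le hN x
  have h1 := emod_lt_of_one_le hN x
  unfold centre circAbs
  split_ifs with h
  · have e : x + N * -(x / (N : ℤ)) = x % (N : ℤ) := by rw [mul_neg]; linarith
    rw [e, abs_of_nonneg h0, min_eq_left (by omega)]
  · have e : x + N * (-(x / (N : ℤ)) - 1) = x % (N : ℤ) - N := by rw [mul_sub, mul_neg, mul_one]; linarith
    rw [e, abs_of_nonpos (by omega), min_eq_right (by omega)]
    ring

/-- on centred representatives `circAbs` is the absolute value: `2|x| ≤ N ⇒ circAbs N x = |x|`. [folklore] -/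
theorem circAbs_of_centred {N : ℕ} (hN : 1 ≤ N) {x : ℤ} (hx : 2 * |x| ≤ N) : circAbs N x = |x| := by
  have hN' : (1 : ℤ) ≤ N := by exact_mod_cast hN
  unfold circAbs
  rcases le_or_gt 0 x with h | h
  · rw [abs_of_nonneg h] at hx ⊢
    rw [Int.emod_eq_of_lt h (by omega), min_eq_left (by omega)]
  · rw [abs_of_neg h] at hx ⊢
    have e : x % (N : ℤ) = x + N := by
      have h2 : (x + N) % (N : ℤ) = x % (N : ℤ) := by
        conv_lhs => rw [show x + (N : ℤ) = x + N * 1 by ring]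
        exact Int.add_mul_emod_self_left x N 1
      rw [← h2, Int.emod_eq_of_lt (by omega) (by omega)]
    rw [e, min_eq_right (by omega)]
    ring

/-- `circAbs N x ≤ |x|`: the torus distance is at most the lattice distance. [folklore] -/
theorem circAbs_le_abs {N : ℕ} (hN : 1 ≤ N) (x : ℤ) : circAbs N x ≤ |x| := by
  have hdiv : (N : ℤ) * (x / (N : ℤ)) + x % (N : ℤ) = x := Int.mul_ediv_add_emod x (N : ℤ)
  have h0 := emod_nonneg_of_one_le hN x
  have h1 := emod_lt_of_one_le hN x
  have hl : circAbs N x ≤ x % (N : ℤ) := min_le_left _ _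
  have hr : circAbs N x ≤ (N : ℤ) - x % (N : ℤ) := min_le_right _ _
  have hN' : (0 : ℤ) ≤ N := by positivity
  rcases lt_trichotomy (x / (N : ℤ)) 0 with hq | hq | hq
  · have hq' : x / (N : ℤ) ≤ -1 := by omega
    have : (N : ℤ) * (x / (N : ℤ)) ≤ -N := by nlinarith
    rw [abs_of_neg (by linarith)]
    linarith
  · rw [hq, mul_zero, zero_add] at hdiv
    rw [abs_of_nonneg (by linarith)]
    linarith
  · have hq' : 1 ≤ x / (N : ℤ) := by omega
    have : (N : ℤ) ≤ N * (x / (N : ℤ)) := by nlinarith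
    rw [abs_of_nonneg (by linarith)]
    linarith

/-- the sup-distance on `Π_μ ℤ/N_μ` between the classes of `x` and `0`: `max_μ dist(x_μ, N_μℤ)` (real-valued, like `supNorm`).
[cite: Balaban1984PropagatorsI, p. 17 l. 30 with p. 36 l. 20–23, dictionary] [folklore] -/
def torusSupNorm (N : Fin (d + 1) → ℕ) (x : Fin (d + 1) → ℤ) : ℝ :=
  Finset.univ.sup' Finset.univ_nonempty (fun i => ((circAbs (N i) (x i) : ℤ) : ℝ))

/-- the centring vector of `x` for the period vector `N`. [folklore] -/
def centreVec (N : Fin (d + 1) → ℕ) (x : Fin (d + 1) → ℤ) : Fin (d + 1) → ℤ := fun i => centre (N i) (x i)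

/-- the centred representative `x₀ = translate N x (centreVec N x)` has `|x₀_μ| = dist(x_μ, N_μℤ)`. [folklore] -/
theorem abs_translate_centreVec {N : Fin (d + 1) → ℕ} (hN : ∀ i, 1 ≤ N i) (x : Fin (d + 1) → ℤ) (i : Fin (d + 1)) :
    |translate N x (centreVec N x) i| = circAbs (N i) (x i) :=
  abs_add_mul_centre (hN i) (x i)

/-- … and is centred: `2|x₀_μ| ≤ N_μ`. [folklore] -/
theorem translate_centreVec_centred {N : Fin (d + 1) → ℕ} (hN : ∀ i, 1 ≤ N i) (x : Fin (d + 1) → ℤ) :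
    ∀ i, 2 * |translate N x (centreVec N x) i| ≤ N i := fun i => by
  rw [abs_translate_centreVec hN x i]
  exact two_mul_circAbs_le (N i) (x i)

/-- … and its sup norm is the torus sup-distance of `x`. [folklore] -/
theorem supNorm_translate_centreVec {N : Fin (d + 1) → ℕ} (hN : ∀ i, 1 ≤ N i) (x : Fin (d + 1) → ℤ) :
    supNorm (translate N x (centreVec N x)) = torusSupNorm N x := by
  simp only [supNorm, torusSupNorm, abs_translate_centreVec hN x]

/-- `0 ≤ torusSupNorm N x`. [folklore] -/
theorem torusSupNorm_nonneg {N : Fin (d + 1) → ℕ} (hN : ∀ i, 1 ≤ N i) (x : Fin (d + 1) → ℤ) : 0 ≤ torusSupNorm N x :=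
  le_trans (by exact_mod_cast circAbs_nonneg (hN 0) (x 0))
    (Finset.le_sup' (fun i => ((circAbs (N i) (x i) : ℤ) : ℝ)) (Finset.mem_univ 0))

/-- the torus sup-distance is at most the lattice sup norm. [folklore] -/
theorem torusSupNorm_le_supNorm {N : Fin (d + 1) → ℕ} (hN : ∀ i, 1 ≤ N i) (x : Fin (d + 1) → ℤ) :
    torusSupNorm N x ≤ supNorm x := by
  refine Finset.sup'_le _ _ fun i _ => le_trans ?_ (abs_le_supNorm x i)
  exact_mod_cast circAbs_le_abs (hN i) (x i)

/-- the torus sup-distance depends only on the class of `x` in `Π_μ ℤ/N_μ`. [folklore] -/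
theorem torusSupNorm_translate (N : Fin (d + 1) → ℕ) (x m : Fin (d + 1) → ℤ) :
    torusSupNorm N (translate N x m) = torusSupNorm N x := by
  simp only [torusSupNorm, translate_apply, circAbs_add_mul]

/-- on centred representatives the torus sup-distance is the sup norm. [folklore] -/
theorem torusSupNorm_of_centred {N : Fin (d + 1) → ℕ} (hN : ∀ i, 1 ≤ N i) {x : Fin (d + 1) → ℤ}
    (hx : ∀ i, 2 * |x i| ≤ N i) : torusSupNorm N x = supNorm x := by
  have h : ∀ i, circAbs (N i) (x i) = |x i| := fun i => circAbs_of_centred (hN i) (hx i)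
  simp only [torusSupNorm, supNorm, h]

/-- the grid characters are `N_μ`-periodic in `x_μ`: `Π_μ e^{2πi (x_μ + N_μ m_μ) k_μ/N_μ} = Π_μ e^{2πi x_μ k_μ/N_μ}`. [folklore] -/
theorem mFourier_translate_gridPt {N : Fin (d + 1) → ℕ} (hN : ∀ i, 1 ≤ N i) (x m : Fin (d + 1) → ℤ)
    (k : (i : Fin (d + 1)) → Fin (N i)) : mFourier (translate N x m) (gridPt N k) = mFourier x (gridPt N k) := by
  show (∏ i, fourier (translate N x m i) (gridPt N k i)) = ∏ i, fourier (x i) (gridPt N k i)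
  refine Finset.prod_congr rfl fun i _ => ?_
  have hNi : ((N i : ℕ) : ℂ) ≠ 0 := by
    have := hN i
    exact_mod_cast (show N i ≠ 0 by omega)
  rw [translate_apply, fourier_add]
  suffices h : fourier ((N i : ℤ) * m i) (gridPt N k i) = 1 by rw [h, mul_one]
  show fourier ((N i : ℤ) * m i) (((((k i : ℕ) : ℝ) / N i : ℝ)) : UnitAddCircle) = 1
  rw [fourier_coe_apply]
  have e : 2 * π * I * (((N i : ℤ) * m i : ℤ) : ℂ) * ((((k i : ℕ) : ℝ) / N i : ℝ) : ℂ) / ((1 : ℝ) : ℂ)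
      = ((m i * (k i : ℕ) : ℤ) : ℂ) * (2 * π * I) := by
    push_cast
    field_simp
  rw [e]
  exact Complex.exp_int_mul_two_pi_mul_I _

/-- PERIODICITY of the torus kernel: `K_N(x + (N_μ m_μ)_μ) = K_N(x)`. [folklore] -/
theorem torusKernel_translate (f : C(UnitAddTorus (Fin (d + 1)), ℂ)) {N : Fin (d + 1) → ℕ} (hN : ∀ i, 1 ≤ N i)
    (x m : Fin (d + 1) → ℤ) : torusKernel f N (translate N x m) = torusKernel f N x := by
  unfold torusKernel torusSum
  congr 1
  exact Finset.sum_congr rfl fun k _ => by rw [mFourier_translate_gridPt hN x m k]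

/-- UNIFORM DECAY IN THE TORUS METRIC, for EVERY `x ∈ ℤ^{d+1}`: `‖ĉ(n)‖ ≤ M e^{-κ|n|_∞}`, `κ > 0`, all `N_μ ≥ 1` ⇒
`‖K_N(x)‖ ≤ M · periodConst κ d · e^{-(κ/(d+1)) · torusSupNorm N x}` (periodicity + the centred statement at the centred
representative). [folklore] -/
theorem torusKernel_decay_torusMetric (f : C(UnitAddTorus (Fin (d + 1)), ℂ)) {κ M : ℝ} (hκ : 0 < κ)
    (hdec : ∀ n, ‖mFourierCoeff f n‖ ≤ M * Real.exp (-(κ * supNorm n))) {N : Fin (d + 1) → ℕ} (hN : ∀ i, 1 ≤ N i)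
    (x : Fin (d + 1) → ℤ) :
    ‖torusKernel f N x‖ ≤ M * periodConst κ d * Real.exp (-(κ / (d + 1) * torusSupNorm N x)) := by
  rw [← torusKernel_translate f hN x (centreVec N x), ← supNorm_translate_centreVec hN x]
  exact torusKernel_decay f hκ hdec hN _ (translate_centreVec_centred hN x)

/-- **B5 (1.126) ON THE TORUS `Π_μ ℤ/N_μ` IN THE TORUS METRIC, generic multiplier, EVERY lattice point**: for a strip-regular
multiplier `G` (`StripRegular G κ M`, `κ > 0`) and all `N_μ ≥ 1`,
`‖MultiPeriod.torusKernel (descendC G h _) N x‖ ≤ M · periodConst κ d · e^{-(κ/(d+1)) · torusSupNorm N x}` for every `x ∈ ℤ^{d+1}`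
— constants depending on `κ, d` only, uniformly in the period vector; with `torusSupNorm_of_centred` this contains §7's
`torusKernel_descend_decay`. [cite: Balaban1984PropagatorsI, p. 38 (1.126) with p. 36 l. 20–23, dictionary] [folklore] -/
theorem torusKernel_descend_decay_torusMetric {G : (Fin (d + 1) → ℂ) → ℂ} {κ M : ℝ} (h : StripRegular G κ M) (hκ : 0 < κ)
    {N : Fin (d + 1) → ℕ} (hN : ∀ i, 1 ≤ N i) (x : Fin (d + 1) → ℤ) :
    ‖torusKernel (descendC G h hκ.le) N x‖ ≤ M * periodConst κ d * Real.exp (-(κ / (d + 1) * torusSupNorm N x)) :=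
  torusKernel_decay_torusMetric _ hκ (norm_mFourierCoeff_descend_le h hκ.le) hN x

/-- the torus-metric bound is never weaker than a bound in the lattice sup norm of ANY representative: for every `m`,
`e^{-(κ'·torusSupNorm N x)} ≤ 1` and `torusSupNorm N x = torusSupNorm N (x + Nm) ≤ |x + Nm|_∞`. (Reader's convenience.) [folklore] -/
theorem torusSupNorm_le_supNorm_translate {N : Fin (d + 1) → ℕ} (hN : ∀ i, 1 ≤ N i) (x m : Fin (d + 1) → ℤ) :
    torusSupNorm N x ≤ supNorm (translate N x m) := by
  rw [← torusSupNorm_translate N x m]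
  exact torusSupNorm_le_supNorm hN _

end MultiPeriod

end

end Literature.MathematicalPhysics.QuantumFieldTheory.Balaban1983to89.B4TorusKernel
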